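import Literature.Analysis.FluidPDE.TrilinearSkew
import Literature.Analysis.FluidPDE.TaoEnstrophyLocalisationProofs
import Mathlib.Analysis.Calculus.ParametricIntervalIntegral
import Mathlib.Analysis.Calculus.FDeriv.Symmetric
import Mathlib.Analysis.SpecialFunctions.Integrals.Basic
import HarnessLib

/-!
# Divergence-free truncation and the density of `C_{c,σ}^∞(ℝ³)` in `H¹_σ(ℝ³)`

Analysis/FluidPDE support file (serves the discharge of the Serrin–Prodi weak–strong uniqueness
theorem `Literature.Analysis.FluidPDE.weak_strong_uniqueness`, sub-fact `Literature.Analysis.FluidPDE.serrin_difference_energy_ineq`: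
Serrin's argument tests the weak formulation of one Leray–Hopf solution with (mollifications of)
the other, which requires extending the accepted weak formulation `Fluid.IsWeakNSSolutionOn` —
stated for smooth *compactly supported* divergence-free test fields — to divergence-free fields
in `H¹`; the extension rests on the density proved here).

**Main result** (`Fluid.exists_isDivFree_test_approx`). Let `E` be a real inner product space of
dimension `3`, `Ψ ∈ L²(E; E)` weakly divergence free with a weak gradient `G`, `∫ |G|² < ∞`.
For every `δ > 0` there is a smooth compactly supported divergence-free field `Φ`
(`IsTestFunctionOn ⊤ Φ ∧ IsDivFree Φ`) with `‖Φ - Ψ‖_{L²} ≤ δ` and `∫ |DΦ - G|² ≤ δ`. This is the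
whole-space case of "`C_{c,σ}^∞` is dense in `H¹_{0,σ}`" (Galdi 2011, Thm. III.4.3; Sohr 2001,
Lemma II.2.5.3; both via Bogovskiĭ's operator on bounded/exterior domains).

**Proof.** Mollify: `Vₙ = φₙ ⋆ Ψ` is smooth, divergence free
(`isDivFree_normed_convolution`: `tr G = 0` a.e. for a weakly divergence-free field,
`ae_traceCLM_eq_zero_of_isWeaklyDivFree`), `Vₙ → Ψ` in `L²` and `DVₙ → G` in `L²` (accepted
`MollificationLp`, `TrilinearSkew`). Truncate: on `ℝ³` the cut-off `χ_R V` of a divergence-free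
`V` is corrected *explicitly* by the **Poincaré homotopy operator** — with
`F(x) = ∫₀¹ t V(tx) dt` (`poincareField`) the antisymmetric tensor `B(x)w = ⟪x,w⟫F(x) - ⟪F(x),w⟫x`
has row-divergence `V` (vector form of the Poincaré lemma for closed `2`-forms, using the radial
identity `DF(x)x + 2F(x) = V(x)`, `fderiv_poincareField_apply_self_add`, and `div F = 0`), so
`Ψ_R = χ_R V + B(∇χ_R)` (`solenoidalTruncation`) is smooth, compactly supported and divergence
free (`isDivFree_solenoidalTruncation`, by the symmetry of `D²χ_R`). The corrector lives on the
annulus `R ≤ ‖x‖ ≤ 2R` and is `O(|F| + |DF|)` there, and the `L²` tails of `F`, `DF` vanish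
(`lintegral_sq_rayAverage`: Cauchy–Schwarz in `t` with weight `t^{-1/2}`, the dilation
`∫ |W(tx)|² dx = t⁻³ ∫ |W|²`, dominated convergence), whence `Ψ_R → V` in `H¹`
(`tendsto_lintegral_solenoidalTruncation_sub`). A general lemma on the smoothness of parametric
integrals `x ↦ ∫ₐᵇ f(x,t) dt` with smooth integrand (`contDiff_intervalIntegral_of_contDiff`)
supplies the smoothness of `F`.

## Mathlib search

Mathlib (this pin) has: differentiation under the integral sign
(`hasFDerivAt_integral_of_dominated_of_fderiv_le`), continuity of parametric integrals, the
Haar scaling `Measure.map_addHaar_smul`, symmetry of second derivatives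
(`ContDiffAt.isSymmSndFDerivAt`), traces (`LinearMap.trace`), mollification
(`ContDiffBump`, `Mathlib.Analysis.Convolution`). It has no divergence operator / solenoidal
spaces, no Bogovskiĭ or Poincaré homotopy operator, and no `C^∞` statement for parametric
integrals (searched `parametric`, `contDiff_.*integral`, `Bogovski`, `solenoidal`, `divergence`
in `Mathlib/Analysis`, `Mathlib/MeasureTheory`). The tree has the cut-off `Fluid.cutoff`
(`WholeSpaceIBP`), `divergence`/`IsDivFree`/`IsWeaklyDivFree`/`HasWeakGradient`
(`VectorCalculus`), the trace functional `Fluid.traceCLM` with `divergence_eq_traceCLM`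
(`TaoEnstrophyLocalisationProofs`), and the mollification toolkit (`Mollification`,
`MollificationLp`, `TrilinearSkew`), all reused.

## References

* G. P. Galdi, *An Introduction to the Mathematical Theory of the Navier–Stokes Equations.
  Steady-State Problems*, 2nd ed., Springer 2011, §III.4, Thm. III.4.3 (density of `C_{c,σ}^∞`
  in `H¹_{0,σ}`).
* H. Sohr, *The Navier–Stokes Equations. An Elementary Functional Analytic Approach*,
  Birkhäuser 2001, Lemma II.2.5.3.
* J. Serrin, *The initial value problem for the Navier–Stokes equations*, in: Nonlinear Problems
  (Madison 1962), Univ. Wisconsin Press 1963, §4 (use of `H¹_σ` test fields).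
* L. C. Evans, *Partial Differential Equations*, 2nd ed. (2010), §5.3 (mollification), App. C.4.
-/

noncomputable section

open MeasureTheory TopologicalSpace Set Function Filter Topology ContinuousLinearMap Module
  intervalIntegral
open scoped ENNReal NNReal Convolution InnerProductSpace RealInnerProductSpace ContDiff

namespace Literature.Analysis.FluidPDE

/-! ### Smoothness of parametric integrals over a compact interval -/

section Parametric

universe u

variable {H : Type u} [NormedAddCommGroup H] [NormedSpace ℝ H] [FiniteDimensional ℝ H]

omit [FiniteDimensional ℝ H] in
/-- The partial derivative in the parameter of a jointly smooth integrand, as a field of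
continuous linear maps: `∂ₓ f (x, t) = D(uncurry f)(x, t) ∘ inl`. [folklore] -/
theorem hasFDerivAt_param_of_contDiff {F : Type*} [NormedAddCommGroup F] [NormedSpace ℝ F]
    {f : H → ℝ → F} (hf : ContDiff ℝ 1 (uncurry f)) (x : H) (t : ℝ) :
    HasFDerivAt (fun y => f y t) ((fderiv ℝ (uncurry f) (x, t)).comp (inl ℝ H ℝ)) x := by
  have h1 : HasFDerivAt (uncurry f) (fderiv ℝ (uncurry f) (x, t)) (x, t) :=
    (hf.differentiable one_ne_zero (x, t)).hasFDerivAt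
  exact h1.comp x (hasFDerivAt_prodMk_left (𝕜 := ℝ) x t)

/-- **Differentiation under the integral sign over a compact interval, smooth integrand.** If
`(x, t) ↦ f x t` is `C¹` then `x ↦ ∫ₐᵇ f x t dt` has derivative `∫ₐᵇ ∂ₓ f x t dt` at every point
(domination by the maximum of `∂ₓ f` on a compact neighbourhood; Mathlib's
`intervalIntegral.hasFDerivAt_integral_of_dominated_of_fderiv_le`). [folklore] -/
theorem hasFDerivAt_intervalIntegral_of_contDiff {F : Type*} [NormedAddCommGroup F]
    [NormedSpace ℝ F] [CompleteSpace F] {f : H → ℝ → F} (hf : ContDiff ℝ 1 (uncurry f))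
    (a b : ℝ) (x₀ : H) :
    HasFDerivAt (fun x => ∫ t in a..b, f x t)
      (∫ t in a..b, (fderiv ℝ (uncurry f) (x₀, t)).comp (inl ℝ H ℝ)) x₀ := by
  set f₁ : H → ℝ → H →L[ℝ] F := fun x t => (fderiv ℝ (uncurry f) (x, t)).comp (inl ℝ H ℝ)
    with hf₁
  have hcont : Continuous (uncurry f) := hf.continuous
  have hcont₁ : Continuous (uncurry f₁) := by
    have : Continuous fun p : H × ℝ => (fderiv ℝ (uncurry f) p).comp (inl ℝ H ℝ) :=
      (hf.continuous_fderiv one_ne_zero).clm_comp continuous_const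
    exact this
  -- a uniform bound of `∂ₓ f` on `closedBall x₀ 1 × [a, b]`
  obtain ⟨C, hC⟩ := ((isCompact_closedBall x₀ 1).prod isCompact_uIcc).exists_bound_of_continuousOn
    (f := uncurry f₁) hcont₁.continuousOn
  refine intervalIntegral.hasFDerivAt_integral_of_dominated_of_fderiv_le (𝕜 := ℝ) (μ := volume)
    (F := f) (F' := f₁) (bound := fun _ => C) (Metric.ball_mem_nhds x₀ one_pos) ?_ ?_ ?_ ?_ ?_ ?_
  · exact Eventually.of_forall fun x =>
      (hcont.comp (Continuous.prodMk_right x)).aestronglyMeasurable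
  · exact (hcont.comp (Continuous.prodMk_right x₀)).intervalIntegrable _ _
  · exact (hcont₁.comp (Continuous.prodMk_right x₀)).aestronglyMeasurable
  · refine Eventually.of_forall fun t ht x hx => hC (x, t) ⟨?_, ?_⟩
    · exact Metric.mem_closedBall.2 (le_of_lt (Metric.mem_ball.1 hx))
    · exact uIoc_subset_uIcc ht
  · exact intervalIntegrable_const
  · exact Eventually.of_forall fun t _ x _ => hasFDerivAt_param_of_contDiff hf x t

/-- **Smoothness of parametric integrals over a compact interval.** If `(x, t) ↦ f x t` is
`C^∞` on `H × ℝ` (`H` finite-dimensional) then `x ↦ ∫ₐᵇ f x t dt` is `C^∞` (induction on the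
order: the derivative is again such an integral, `hasFDerivAt_intervalIntegral_of_contDiff`). [folklore] -/
theorem contDiff_intervalIntegral_of_contDiff {F : Type u} [NormedAddCommGroup F]
    [NormedSpace ℝ F] [CompleteSpace F] {f : H → ℝ → F} (hf : ContDiff ℝ ∞ (uncurry f))
    (a b : ℝ) : ContDiff ℝ ∞ (fun x => ∫ t in a..b, f x t) := by
  suffices key : ∀ (n : ℕ) {F : Type u} [NormedAddCommGroup F] [NormedSpace ℝ F] [CompleteSpace F]
      {f : H → ℝ → F}, ContDiff ℝ ∞ (uncurry f) → ContDiff ℝ n (fun x => ∫ t in a..b, f x t) from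
    contDiff_infty.2 fun n => key n hf
  intro n
  induction n with
  | zero =>
    intro F _ _ _ f hf
    exact contDiff_zero.2
      (intervalIntegral.continuous_parametric_intervalIntegral_of_continuous' hf.continuous a b)
  | succ n ih =>
    intro F _ _ _ f hf
    have hf1 : ContDiff ℝ 1 (uncurry f) := hf.of_le (by exact_mod_cast le_top)
    set f₁ : H → ℝ → H →L[ℝ] F := fun x t => (fderiv ℝ (uncurry f) (x, t)).comp (inl ℝ H ℝ)
      with hf₁
    have hD : ∀ x, HasFDerivAt (fun x => ∫ t in a..b, f x t) (∫ t in a..b, f₁ x t) x :=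
      fun x => hasFDerivAt_intervalIntegral_of_contDiff hf1 a b x
    have hderiv : fderiv ℝ (fun x => ∫ t in a..b, f x t) = fun x => ∫ t in a..b, f₁ x t :=
      funext fun x => (hD x).fderiv
    have hf₁s : ContDiff ℝ ∞ (uncurry f₁) := by
      have : ContDiff ℝ ∞ fun p : H × ℝ => (fderiv ℝ (uncurry f) p).comp (inl ℝ H ℝ) :=
        (hf.fderiv_right (by exact_mod_cast le_top)).clm_comp contDiff_const
      exact this
    rw [show ((n + 1 : ℕ) : WithTop ℕ∞) = (n : WithTop ℕ∞) + 1 by push_cast; rfl,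
      contDiff_succ_iff_fderiv]
    refine ⟨fun x => (hD x).differentiableAt, fun h => ?_, ?_⟩
    · exact absurd h (by simp)
    · rw [hderiv]
      exact ih hf₁s

end Parametric

end Literature.Analysis.FluidPDE

namespace Literature.Analysis.FluidPDE

variable {E : Type*} [NormedAddCommGroup E] [InnerProductSpace ℝ E] [FiniteDimensional ℝ E]

/-! ### The Poincaré homotopy field `F(x) = ∫₀¹ t V(t x) dt` -/

section Poincare

/-- The **Poincaré homotopy field** of a vector field `V`:
`poincareField V x = ∫₀¹ t V(t x) dt`. For divergence-free `V` on a `3`-dimensional space the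
antisymmetric tensor `B(x) w = ⟪x, w⟫ F(x) - ⟪F(x), w⟫ x` built from `F = poincareField V` has
row-wise divergence `V` — the vector-field form of the Poincaré lemma for closed `2`-forms on
`ℝ³` (homotopy operator centred at `0`); the weight `t = t^{n-2}` is the one for which
`DF(x) x + (n - 1) F(x) = V(x)` in dimension `n = 3` (`fderiv_poincareField_apply_self_add`). [folklore] -/
def poincareField (V : E → E) (x : E) : E :=
  ∫ t in (0 : ℝ)..1, t • V (t • x)

variable {V : E → E}

omit [FiniteDimensional ℝ E] in
/-- Unfolding `poincareField`. [folklore] -/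
theorem poincareField_apply (V : E → E) (x : E) :
    poincareField V x = ∫ t in (0 : ℝ)..1, t • V (t • x) := rfl

omit [FiniteDimensional ℝ E] in
/-- The integrand `(x, t) ↦ t V(t x)` of the Poincaré field is jointly smooth for smooth `V`. [folklore] -/
theorem contDiff_uncurry_smul_comp_smul {n : WithTop ℕ∞} (hV : ContDiff ℝ n V) :
    ContDiff ℝ n (uncurry fun (x : E) (t : ℝ) => t • V (t • x)) := by
  have h1 : ContDiff ℝ n fun p : E × ℝ => p.2 • V (p.2 • p.1) :=
    contDiff_snd.smul (hV.comp (contDiff_snd.smul contDiff_fst))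
  exact h1

/-- The Poincaré field of a smooth vector field is smooth
(`contDiff_intervalIntegral_of_contDiff`). [folklore] -/
theorem contDiff_poincareField (hV : ContDiff ℝ ∞ V) : ContDiff ℝ ∞ (poincareField V) :=
  contDiff_intervalIntegral_of_contDiff (contDiff_uncurry_smul_comp_smul hV) 0 1

omit [FiniteDimensional ℝ E] in
/-- The partial derivative in `x` of the integrand `t V(t x)` is `t² DV(t x)`. [folklore] -/
theorem hasFDerivAt_smul_comp_smul (hV : ContDiff ℝ 1 V) (t : ℝ) (x : E) :
    HasFDerivAt (fun y : E => t • V (t • y)) ((t ^ 2) • fderiv ℝ V (t • x)) x := by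
  have h1 : HasFDerivAt (fun y : E => t • y) (t • ContinuousLinearMap.id ℝ E) x :=
    (hasFDerivAt_id x).const_smul t
  have h2 : HasFDerivAt V (fderiv ℝ V (t • x)) (t • x) :=
    (hV.differentiable one_ne_zero _).hasFDerivAt
  have h3 : HasFDerivAt (fun y : E => t • V (t • y))
      (t • (fderiv ℝ V (t • x)).comp (t • ContinuousLinearMap.id ℝ E)) x :=
    (h2.comp x h1).const_smul t
  convert h3 using 1
  ext v
  simp [pow_two, smul_smul]

/-- **Derivative of the Poincaré field**: `DF(x) = ∫₀¹ t² DV(t x) dt` for `C¹` fields `V`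
(differentiation under the integral sign). [folklore] -/
theorem hasFDerivAt_poincareField (hV : ContDiff ℝ 1 V) (x : E) :
    HasFDerivAt (poincareField V) (∫ t in (0 : ℝ)..1, (t ^ 2) • fderiv ℝ V (t • x)) x := by
  have h := hasFDerivAt_intervalIntegral_of_contDiff (contDiff_uncurry_smul_comp_smul hV) 0 1 x
  have heq : ∀ t : ℝ, (fderiv ℝ (uncurry fun (y : E) (t : ℝ) => t • V (t • y)) (x, t)).comp
      (inl ℝ E ℝ) = (t ^ 2) • fderiv ℝ V (t • x) := fun t =>
    (hasFDerivAt_param_of_contDiff (contDiff_uncurry_smul_comp_smul hV) x t).unique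
      (hasFDerivAt_smul_comp_smul hV t x)
  simp_rw [heq] at h
  exact h

/-- `fderiv` form of `hasFDerivAt_poincareField`. [folklore] -/
theorem fderiv_poincareField (hV : ContDiff ℝ 1 V) (x : E) :
    fderiv ℝ (poincareField V) x = ∫ t in (0 : ℝ)..1, (t ^ 2) • fderiv ℝ V (t • x) :=
  (hasFDerivAt_poincareField hV x).fderiv

/-- **The radial identity** `DF(x) x + 2 F(x) = V(x)`: along the ray,
`d/dt [t² V(t x)] = 2t V(t x) + t² DV(t x) x`, and the fundamental theorem of calculus on
`[0, 1]`. [folklore] -/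
theorem fderiv_poincareField_apply_self_add (hV : ContDiff ℝ 1 V) (x : E) :
    fderiv ℝ (poincareField V) x x + (2 : ℝ) • poincareField V x = V x := by
  haveI : CompleteSpace E := FiniteDimensional.complete ℝ E
  have hVd : Differentiable ℝ V := hV.differentiable one_ne_zero
  have hVc : Continuous V := hV.continuous
  have hDVc : Continuous (fderiv ℝ V) := hV.continuous_fderiv one_ne_zero
  -- the derivative along the ray
  have hray : ∀ t : ℝ, HasDerivAt (fun s : ℝ => (s ^ 2) • V (s • x))
      ((t ^ 2) • fderiv ℝ V (t • x) x + (2 * t) • V (t • x)) t := by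
    intro t
    have h1 : HasDerivAt (fun s : ℝ => s • x) x t := by
      simpa using (hasDerivAt_id t).smul_const x
    have h2 : HasDerivAt (fun s : ℝ => V (s • x)) (fderiv ℝ V (t • x) x) t :=
      (hVd (t • x)).hasFDerivAt.comp_hasDerivAt t h1
    have h3 : HasDerivAt (fun s : ℝ => s ^ 2) (2 * t) t := by
      simpa using hasDerivAt_pow 2 t
    exact h3.smul h2
  have hi1 : IntervalIntegrable (fun t : ℝ => (2 * t) • V (t • x)) volume 0 1 :=
    ((continuous_const.mul continuous_id).smul
      (hVc.comp (continuous_id.smul continuous_const))).intervalIntegrable 0 1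
  have hi2 : IntervalIntegrable (fun t : ℝ => (t ^ 2) • fderiv ℝ V (t • x) x) volume 0 1 :=
    ((continuous_id.pow 2).smul ((hDVc.comp (continuous_id.smul continuous_const)).clm_apply
      continuous_const)).intervalIntegrable 0 1
  have hFTC := intervalIntegral.integral_eq_sub_of_hasDerivAt (fun t _ => hray t) (hi2.add hi1)
  simp only [one_pow, one_smul, ne_eq, OfNat.ofNat_ne_zero, not_false_eq_true, zero_pow,
    zero_smul, sub_zero] at hFTC
  -- split the integral
  rw [intervalIntegral.integral_add hi2 hi1] at hFTC
  have hA : ∫ t in (0 : ℝ)..1, (2 * t) • V (t • x) = (2 : ℝ) • poincareField V x := by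
    rw [poincareField, ← intervalIntegral.integral_smul]
    congr 1
    ext t
    rw [mul_smul]
  have hB : ∫ t in (0 : ℝ)..1, (t ^ 2) • fderiv ℝ V (t • x) x = fderiv ℝ (poincareField V) x x := by
    rw [fderiv_poincareField hV x]
    have hi3 : IntervalIntegrable (fun t : ℝ => (t ^ 2) • fderiv ℝ V (t • x)) volume 0 1 :=
      ((continuous_id.pow 2).smul (hDVc.comp (continuous_id.smul continuous_const)))
        |>.intervalIntegrable 0 1
    have h4 := (ContinuousLinearMap.apply ℝ E x).intervalIntegral_comp_comm hi3
    simpa only [ContinuousLinearMap.apply_apply, _root_.FunLike.coe_smul, Pi.smul_apply]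
      using h4
  rw [hA, hB] at hFTC
  rw [← hFTC]

/-! #### Divergence of the Poincaré field -/

/-- The trace of the identity is the dimension. [folklore] -/
theorem traceCLM_id : traceCLM (ContinuousLinearMap.id ℝ E) = (finrank ℝ E : ℝ) := by
  rw [traceCLM_apply, ContinuousLinearMap.coe_id]
  exact LinearMap.trace_id ℝ E

/-- **The Poincaré field of a divergence-free field is divergence free**:
`div F(x) = ∫₀¹ t² (div V)(t x) dt = 0` (trace under the integral sign). [folklore] -/
theorem divergence_poincareField (hV : ContDiff ℝ 1 V) (hdiv : VectorCalculus.IsDivFree V) (x : E) :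
    VectorCalculus.divergence (poincareField V) x = 0 := by
  have hDVc : Continuous (fderiv ℝ V) := hV.continuous_fderiv one_ne_zero
  have hi3 : IntervalIntegrable (fun t : ℝ => (t ^ 2) • fderiv ℝ V (t • x)) volume 0 1 :=
    ((continuous_id.pow 2).smul (hDVc.comp (continuous_id.smul continuous_const)))
      |>.intervalIntegrable 0 1
  rw [divergence_eq_traceCLM, fderiv_poincareField hV x,
    ← traceCLM.intervalIntegral_comp_comm hi3]
  have : ∀ t : ℝ, traceCLM ((t ^ 2) • fderiv ℝ V (t • x)) = 0 := fun t => by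
    rw [map_smul, ← divergence_eq_traceCLM, hdiv (t • x), smul_zero]
  simp [this]

end Poincare

/-! ### Second-order facts on the cut-off `Fluid.cutoff R` -/

section Cutoff2

/-- **Hessian bound for the cut-off**: there is `C ≥ 0` with `‖D²(cutoff R)(x)‖ ≤ C / R²` for all
`R > 0` and all `x` (chain rule twice, `D²(χ(·/R)) = R⁻² D²χ(·/R)`). [folklore] -/
theorem exists_norm_fderiv_fderiv_cutoff_le :
    ∃ C : ℝ, 0 ≤ C ∧ ∀ R : ℝ, 0 < R → ∀ x : E,
      ‖fderiv ℝ (fderiv ℝ (cutoff R)) x‖ ≤ C / R ^ 2 := by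
  set χ₀ : E → ℝ := (FunctionSpaces.dyadicCutoff E : E → ℝ) with hχ₀
  have hsm : ContDiff ℝ 2 χ₀ := (FunctionSpaces.dyadicCutoff E).contDiff
  have hd : ∀ y, DifferentiableAt ℝ (fderiv ℝ χ₀) y := fun y =>
    ((hsm.fderiv_right (m := 1) le_rfl).differentiable one_ne_zero) y
  obtain ⟨C, hC⟩ := ((hsm.fderiv_right (m := 1) le_rfl).continuous_fderiv one_ne_zero)
    |>.bounded_above_of_compact_support
    (((FunctionSpaces.dyadicCutoff E).hasCompactSupport.fderiv (𝕜 := ℝ)).fderiv (𝕜 := ℝ))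
  refine ⟨max C 0, le_max_right _ _, fun R hR x => ?_⟩
  have h1 : fderiv ℝ (cutoff (E := E) R) = fun x => (R⁻¹ • fderiv ℝ χ₀) (R⁻¹ • x) :=
    funext fun x => fderiv_comp_smul (𝕜 := ℝ) (f := χ₀) (x := x) R⁻¹
  have h2 : fderiv ℝ (fderiv ℝ (cutoff (E := E) R)) x =
      R⁻¹ • (R⁻¹ • fderiv ℝ (fderiv ℝ χ₀) (R⁻¹ • x)) := by
    rw [h1, fderiv_comp_smul (𝕜 := ℝ) (f := R⁻¹ • fderiv ℝ χ₀) R⁻¹, fderiv_const_smul (hd _)]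
  rw [h2]
  have hRinv : 0 ≤ R⁻¹ := inv_nonneg.2 hR.le
  refine ContinuousLinearMap.opNorm_le_bound _ (by positivity) fun v => ?_
  rw [_root_.FunLike.coe_smul, Pi.smul_apply, _root_.FunLike.coe_smul, Pi.smul_apply,
    norm_smul, norm_smul, Real.norm_of_nonneg hRinv]
  calc R⁻¹ * (R⁻¹ * ‖fderiv ℝ (fderiv ℝ χ₀) (R⁻¹ • x) v‖)
      ≤ R⁻¹ * (R⁻¹ * (max C 0 * ‖v‖)) := by
        gcongr
        exact (ContinuousLinearMap.le_opNorm _ _).trans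
          (mul_le_mul_of_nonneg_right ((hC _).trans (le_max_left _ _)) (norm_nonneg _))
    _ = max C 0 / R ^ 2 * ‖v‖ := by
        field_simp

omit [FiniteDimensional ℝ E] in
/-- The cut-off is locally constant (`= 1`) inside the ball of radius `R`, so its derivative
vanishes there. [folklore] -/
theorem fderiv_cutoff_eventuallyEq_zero_of_norm_lt {R : ℝ} (hR : 0 < R) {x : E} (hx : ‖x‖ < R) :
    fderiv ℝ (cutoff (E := E) R) =ᶠ[𝓝 x] fun _ => 0 := by
  have hopen : IsOpen {y : E | ‖y‖ < R} := isOpen_lt continuous_norm continuous_const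
  filter_upwards [hopen.mem_nhds hx] with y hy
  have hloc : cutoff (E := E) R =ᶠ[𝓝 y] fun _ => (1 : ℝ) := by
    filter_upwards [hopen.mem_nhds hy] with z hz using cutoff_eq_one hR (le_of_lt hz)
  rw [hloc.fderiv_eq]
  exact congrFun (fderiv_const (1 : ℝ)) y

omit [FiniteDimensional ℝ E] in
/-- The cut-off vanishes identically outside the ball of radius `2R`, so its derivative vanishes
there. [folklore] -/
theorem fderiv_cutoff_eventuallyEq_zero_of_lt_norm {R : ℝ} (hR : 0 < R) {x : E}
    (hx : 2 * R < ‖x‖) : fderiv ℝ (cutoff (E := E) R) =ᶠ[𝓝 x] fun _ => 0 := by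
  have hopen : IsOpen {y : E | 2 * R < ‖y‖} := isOpen_lt continuous_const continuous_norm
  filter_upwards [hopen.mem_nhds hx] with y hy
  have hloc : cutoff (E := E) R =ᶠ[𝓝 y] fun _ => (0 : ℝ) := by
    filter_upwards [hopen.mem_nhds hy] with z hz using cutoff_eq_zero hR (le_of_lt hz)
  rw [hloc.fderiv_eq]
  exact congrFun (fderiv_const (0 : ℝ)) y

omit [FiniteDimensional ℝ E] in
/-- Off the closed annulus `R ≤ ‖x‖ ≤ 2R` both `D(cutoff R)` and `D²(cutoff R)` vanish. [folklore] -/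
theorem fderiv_cutoff_eq_zero_of_not_mem {R : ℝ} (hR : 0 < R) {x : E}
    (hx : ¬ (R ≤ ‖x‖ ∧ ‖x‖ ≤ 2 * R)) :
    fderiv ℝ (cutoff (E := E) R) x = 0 ∧ fderiv ℝ (fderiv ℝ (cutoff (E := E) R)) x = 0 := by
  have h : fderiv ℝ (cutoff (E := E) R) =ᶠ[𝓝 x] fun _ => 0 := by
    rcases not_and_or.1 hx with h1 | h2
    · exact fderiv_cutoff_eventuallyEq_zero_of_norm_lt hR (not_le.1 h1)
    · exact fderiv_cutoff_eventuallyEq_zero_of_lt_norm hR (not_le.1 h2)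
  refine ⟨h.eq_of_nhds, ?_⟩
  rw [h.fderiv_eq]
  exact congrFun (fderiv_const (0 : E →L[ℝ] ℝ)) x

omit [FiniteDimensional ℝ E] in
/-- The Hessian of the (smooth) cut-off is symmetric. [folklore] -/
theorem fderiv_fderiv_cutoff_symm (R : ℝ) (x v w : E) :
    fderiv ℝ (fderiv ℝ (cutoff (E := E) R)) x v w = fderiv ℝ (fderiv ℝ (cutoff (E := E) R)) x w v :=
  ((contDiff_cutoff (n := 2) R).contDiffAt (x := x)).isSymmSndFDerivAt
    (by simp [minSmoothness_of_isRCLikeNormedField]) v w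

end Cutoff2

/-! ### The solenoidal truncation `Ψ_R = χ_R V + Dχ_R(x) F - Dχ_R(F) x` -/

section Truncation

/-- **Divergence-free truncation of a divergence-free field** (dimension `3`). With the cut-off
`χ_R = Fluid.cutoff R` and the Poincaré field `F = poincareField V`,
`solenoidalTruncation V R x = χ_R(x) V(x) + Dχ_R(x)[x] F(x) - Dχ_R(x)[F(x)] x`,
i.e. `χ_R V + B(∇χ_R)` with the antisymmetric tensor `B(x)w = ⟪x,w⟫F(x) - ⟪F(x),w⟫x`
(row-wise `div B = V`): compactly supported in `‖x‖ ≤ 2R`, smooth, and divergence free when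
`V` is; the corrector lives on the annulus `R ≤ ‖x‖ ≤ 2R` and is `O(|F|)` there. This is the
whole-space substitute for the Bogovskiĭ corrector in the proof that compactly supported
solenoidal test fields are dense in `H¹_σ(ℝ³)` (Galdi, *An Introduction to the Mathematical Theory
of the Navier–Stokes Equations*, 2nd ed. 2011, Thm. III.4.3 for general domains; here by the
explicit Poincaré homotopy). [folklore] -/
def solenoidalTruncation (V : E → E) (R : ℝ) (x : E) : E :=
  cutoff R x • V x + (fderiv ℝ (cutoff R) x x) • poincareField V x -
    (fderiv ℝ (cutoff R) x (poincareField V x)) • x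

variable {V : E → E} {R : ℝ}

/-- The derivative of the solenoidal truncation (Leibniz rules). [folklore] -/
theorem hasFDerivAt_solenoidalTruncation (hV : ContDiff ℝ 1 V) (R : ℝ) (x : E) :
    HasFDerivAt (solenoidalTruncation V R)
      (cutoff R x • fderiv ℝ V x + (fderiv ℝ (cutoff R) x).smulRight (V x) +
        ((fderiv ℝ (cutoff R) x x) • fderiv ℝ (poincareField V) x +
          ((fderiv ℝ (cutoff R) x).comp (ContinuousLinearMap.id ℝ E) +
            (fderiv ℝ (fderiv ℝ (cutoff R)) x).flip x).smulRight (poincareField V x)) -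
        ((fderiv ℝ (cutoff R) x (poincareField V x)) • ContinuousLinearMap.id ℝ E +
          ((fderiv ℝ (cutoff R) x).comp (fderiv ℝ (poincareField V) x) +
            (fderiv ℝ (fderiv ℝ (cutoff R)) x).flip (poincareField V x)).smulRight x)) x := by
  have hχ : HasFDerivAt (cutoff (E := E) R) (fderiv ℝ (cutoff R) x) x :=
    ((contDiff_cutoff (n := 1) R).differentiable one_ne_zero x).hasFDerivAt
  have hDχ : HasFDerivAt (fderiv ℝ (cutoff (E := E) R)) (fderiv ℝ (fderiv ℝ (cutoff R)) x) x :=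
    (((contDiff_cutoff (n := 2) R).fderiv_right (m := 1) le_rfl).differentiable one_ne_zero x)
      |>.hasFDerivAt
  have hVx : HasFDerivAt V (fderiv ℝ V x) x := (hV.differentiable one_ne_zero x).hasFDerivAt
  have hF : HasFDerivAt (poincareField V) (fderiv ℝ (poincareField V) x) x :=
    hasFDerivAt_poincareField hV x |>.differentiableAt.hasFDerivAt
  have h1 := hχ.smul hVx
  have ha := hDχ.clm_apply (hasFDerivAt_id x)
  have h2 := ha.smul hF
  have hb := hDχ.clm_apply hF
  have h3 := hb.smul (hasFDerivAt_id x)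
  exact (h1.add h2).sub h3

/-- The solenoidal truncation of a smooth field is smooth. [folklore] -/
theorem contDiff_solenoidalTruncation (hV : ContDiff ℝ ∞ V) (R : ℝ) :
    ContDiff ℝ ∞ (solenoidalTruncation V R) := by
  have hχ : ContDiff ℝ ∞ (cutoff (E := E) R) := contDiff_cutoff (n := ⊤) R
  have hDχ : ContDiff ℝ ∞ (fderiv ℝ (cutoff (E := E) R)) :=
    hχ.fderiv_right (by exact_mod_cast le_top)
  have hF : ContDiff ℝ ∞ (poincareField V) := contDiff_poincareField hV
  exact ((hχ.smul hV).add ((hDχ.clm_apply contDiff_id).smul hF)).sub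
    ((hDχ.clm_apply hF).smul contDiff_id)

omit [FiniteDimensional ℝ E] in
/-- The solenoidal truncation vanishes outside the ball of radius `2R`. [folklore] -/
theorem solenoidalTruncation_eq_zero (hR : 0 < R) {x : E} (hx : 2 * R < ‖x‖) :
    solenoidalTruncation V R x = 0 := by
  have h1 : cutoff (E := E) R x = 0 := cutoff_eq_zero hR hx.le
  have h2 : fderiv ℝ (cutoff (E := E) R) x = 0 :=
    (fderiv_cutoff_eq_zero_of_not_mem hR (fun h => (not_lt.2 h.2) hx)).1
  simp [solenoidalTruncation, h1, h2]

/-- The solenoidal truncation is compactly supported (in the closed ball of radius `2R`). [folklore] -/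
theorem hasCompactSupport_solenoidalTruncation (hR : 0 < R) :
    HasCompactSupport (solenoidalTruncation V R) := by
  refine HasCompactSupport.intro (isCompact_closedBall (0 : E) (2 * R)) fun x hx => ?_
  rw [mem_closedBall_zero_iff, not_le] at hx
  exact solenoidalTruncation_eq_zero hR hx

/-- **The solenoidal truncation is a smooth compactly supported (test) field.** [folklore] -/
theorem isTestFunctionOn_solenoidalTruncation (hV : ContDiff ℝ ∞ V) (hR : 0 < R) :
    FunctionSpaces.IsTestFunctionOn (⊤ : Opens E) (solenoidalTruncation V R) where
  contDiff := contDiff_solenoidalTruncation hV R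
  hasCompactSupport := hasCompactSupport_solenoidalTruncation hR
  tsupport_subset := by simp

/-- **The solenoidal truncation of a divergence-free field is divergence free** (dimension `3`):
`div(χV) = Dχ(V)`, `div(Dχ(x)F) = Dχ(F) + D²χ(F, x)`, `div(Dχ(F)x) = 3Dχ(F) + Dχ(DF x) + D²χ(x, F)`,
and `Dχ(V) + Dχ(F) - 3Dχ(F) - Dχ(DF x) = Dχ(V - 2F - DF x) = 0` by the radial identity, the
Hessian being symmetric and `div V = div F = 0`. [folklore] -/
theorem isDivFree_solenoidalTruncation (hE : finrank ℝ E = 3) (hV : ContDiff ℝ 1 V)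
    (hdiv : VectorCalculus.IsDivFree V) (R : ℝ) : VectorCalculus.IsDivFree (solenoidalTruncation V R) := by
  intro x
  rw [divergence_eq_traceCLM, (hasFDerivAt_solenoidalTruncation hV R x).fderiv]
  have hV0 : traceCLM (fderiv ℝ V x) = 0 := by rw [← divergence_eq_traceCLM]; exact hdiv x
  have hF0 : traceCLM (fderiv ℝ (poincareField V) x) = 0 := by
    rw [← divergence_eq_traceCLM]; exact divergence_poincareField hV hdiv x
  have hrad := fderiv_poincareField_apply_self_add hV x
  have hsymm := fderiv_fderiv_cutoff_symm R x (poincareField V x) x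
  simp only [map_add, map_sub, map_smul, traceCLM_smulRight, traceCLM_id, hV0, hF0, hE,
    _root_.add_apply, ContinuousLinearMap.comp_apply,
    ContinuousLinearMap.id_apply, ContinuousLinearMap.flip_apply, smul_eq_mul]
  rw [← hrad, hsymm]
  simp only [map_add, map_smul, smul_eq_mul]
  push_cast
  ring

end Truncation

/-! ### `L²` tails of the Poincaré field -/

section TailGeneral

variable {X : Type*} [MeasurableSpace X]

/-- Cauchy–Schwarz for lower integrals, squared form: `(∫ f g)² ≤ (∫ f²)(∫ g²)`. [folklore] -/
theorem lintegral_mul_sq_le {μ : Measure X} {f g : X → ℝ≥0∞} (hf : AEMeasurable f μ)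
    (hg : AEMeasurable g μ) :
    (∫⁻ x, f x * g x ∂μ) ^ 2 ≤ (∫⁻ x, f x ^ 2 ∂μ) * ∫⁻ x, g x ^ 2 ∂μ := by
  have h := ENNReal.lintegral_mul_le_Lp_mul_Lq μ Real.HolderConjugate.two_two hf hg
  have h2 : ∀ x : ℝ≥0∞, x ^ (2 : ℝ) = x ^ 2 := fun x => by
    rw [show (2 : ℝ) = ((2 : ℕ) : ℝ) by norm_num, ENNReal.rpow_natCast]
  calc (∫⁻ x, f x * g x ∂μ) ^ 2
      ≤ ((∫⁻ x, f x ^ (2 : ℝ) ∂μ) ^ (1 / 2 : ℝ) * (∫⁻ x, g x ^ (2 : ℝ) ∂μ) ^ (1 / 2 : ℝ)) ^ 2 := by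
        gcongr; simpa using h
    _ = (∫⁻ x, f x ^ 2 ∂μ) * ∫⁻ x, g x ^ 2 ∂μ := by
        rw [mul_pow, ← h2, ← h2, ← ENNReal.rpow_mul, ← ENNReal.rpow_mul]
        norm_num

variable {Y : Type*} [NormedAddCommGroup Y] [MeasurableSpace Y] [OpensMeasurableSpace Y]

/-- The exterior regions `{R ≤ ‖x‖}` are measurable. [folklore] -/
theorem measurableSet_norm_ge (R : ℝ) :
    MeasurableSet {x : Y | R ≤ ‖x‖} :=
  (isClosed_le continuous_const continuous_norm).measurableSet

/-- **Tails of a finite lower integral vanish**: `∫_{‖x‖ ≥ ρ} f → 0` as `ρ → ∞`. [folklore] -/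
theorem tendsto_setLIntegral_norm_ge {μ : Measure Y} {f : Y → ℝ≥0∞} (hf : Measurable f)
    (hfin : ∫⁻ x, f x ∂μ ≠ ⊤) :
    Tendsto (fun ρ : ℝ => ∫⁻ x in {x | ρ ≤ ‖x‖}, f x ∂μ) atTop (𝓝 0) := by
  have h0 : (0 : ℝ≥0∞) = ∫⁻ _ : Y, 0 ∂μ := by simp
  rw [h0]
  simp_rw [← lintegral_indicator (measurableSet_norm_ge _)]
  refine tendsto_lintegral_filter_of_dominated_convergence f
    (Eventually.of_forall fun ρ => hf.indicator (measurableSet_norm_ge ρ))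
    (Eventually.of_forall fun ρ => Eventually.of_forall fun x =>
      indicator_le_self _ _ _) hfin (Eventually.of_forall fun x => ?_)
  refine tendsto_const_nhds.congr' ?_
  filter_upwards [eventually_gt_atTop ‖x‖] with ρ hρ
  rw [indicator_of_notMem]
  simpa using hρ

omit [OpensMeasurableSpace Y] in
/-- The tail integral is antitone in the radius. [folklore] -/
theorem antitone_setLIntegral_norm_ge {μ : Measure Y} (f : Y → ℝ≥0∞) :
    Antitone fun ρ : ℝ => ∫⁻ x in {x | ρ ≤ ‖x‖}, f x ∂μ :=
  fun _ _ h => lintegral_mono_set fun _ hx => le_trans h hx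

end TailGeneral

section Tail

variable [MeasurableSpace E] [BorelSpace E]
variable {F' : Type*} [NormedAddCommGroup F'] [NormedSpace ℝ F']

/-- **Scaling of Lebesgue measure under dilations**, lower-integral form:
`∫ g(t x) dx = |t|^{-n} ∫ g` for `t ≠ 0`. [folklore] -/
theorem lintegral_comp_smul (g : E → ℝ≥0∞) {t : ℝ} (ht : t ≠ 0) :
    ∫⁻ x, g (t • x) = ENNReal.ofReal |(t ^ finrank ℝ E)⁻¹| * ∫⁻ y, g y := by
  calc ∫⁻ x, g (t • x) = ∫⁻ y, g y ∂(Measure.map (fun x : E => t • x) volume) :=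
        (lintegral_map_equiv g (Homeomorph.smul (isUnit_iff_ne_zero.2 ht).unit).toMeasurableEquiv).symm
    _ = ENNReal.ofReal |(t ^ finrank ℝ E)⁻¹| * ∫⁻ y, g y := by
        rw [Measure.map_addHaar_smul volume ht, lintegral_smul_measure, smul_eq_mul]


/-- `∫₀¹ t^{-1/2} dt < ⊤` as a lower integral. [folklore] -/
theorem lintegral_rpow_neg_half_lt_top :
    ∫⁻ t in Ioo (0 : ℝ) 1, ENNReal.ofReal (t ^ (-(1 / 2) : ℝ)) < ⊤ := by
  have h : IntervalIntegrable (fun t : ℝ => t ^ (-(1 / 2) : ℝ)) volume 0 1 :=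
    intervalIntegral.intervalIntegrable_rpow' (by norm_num)
  have h' : IntegrableOn (fun t : ℝ => t ^ (-(1 / 2) : ℝ)) (Ioo 0 1) volume :=
    (h.1.mono_set Ioo_subset_Ioc_self)
  exact h'.setLIntegral_lt_top

omit [NormedSpace ℝ F'] in
/-- **`L²` tails of ray averages** (dimension `3`). Let `W : E → F'` be continuous with
`∫ ‖W‖² < ∞` and `k ≥ 1`. For the ray average `I(x) = ∫₀¹ tᵏ ‖W(t x)‖ dt` one has `∫ I² < ∞` and
`∫_{‖x‖ ≥ R} I(x)² dx → 0` as `R → ∞`: by Cauchy–Schwarz in `t` with the weight `t^{-1/2}`,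
`I(x)² ≤ C₀ ∫₀¹ t^{2k+1/2} ‖W(tx)‖² dt`, and after the dilation `x ↦ tx` (Jacobian `t⁻³`)
`∫_{‖x‖≥R} I² ≤ C₀ ∫₀¹ t^{2k-5/2} m(tR) dt ≤ C₀ ∫₀¹ t^{-1/2} m(tR) dt` with the tail mass
`m(ρ) = ∫_{‖y‖≥ρ} ‖W‖² → 0`, dominated by `t^{-1/2} ∫‖W‖²`. This controls the Poincaré field
`F = ∫₀¹ t V(tx) dt` (`k = 1`) and its derivative `DF = ∫₀¹ t² DV(tx) dt` (`k = 2`) at infinity. [folklore] -/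
theorem lintegral_sq_rayAverage (hE : finrank ℝ E = 3) {W : E → F'} (hW : Continuous W)
    (hW2 : ∫⁻ x, ‖W x‖ₑ ^ 2 < ⊤) {k : ℕ} (hk : 1 ≤ k) :
    (∫⁻ x, (∫⁻ t in Ioo (0 : ℝ) 1, ENNReal.ofReal (t ^ k) * ‖W (t • x)‖ₑ) ^ 2 < ⊤) ∧
    Tendsto (fun R : ℝ => ∫⁻ x in {x | R ≤ ‖x‖},
      (∫⁻ t in Ioo (0 : ℝ) 1, ENNReal.ofReal (t ^ k) * ‖W (t • x)‖ₑ) ^ 2) atTop (𝓝 0) := by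
  -- notation
  set C₀ : ℝ≥0∞ := ∫⁻ t in Ioo (0 : ℝ) 1, ENNReal.ofReal (t ^ (-(1 / 2) : ℝ)) with hC₀
  have hC₀fin : C₀ < ⊤ := lintegral_rpow_neg_half_lt_top
  set M : ℝ≥0∞ := ∫⁻ x, ‖W x‖ₑ ^ 2 with hM
  set m : ℝ → ℝ≥0∞ := fun ρ => ∫⁻ y in {y | ρ ≤ ‖y‖}, ‖W y‖ₑ ^ 2 with hm
  have hm_le : ∀ ρ, m ρ ≤ M := fun ρ => setLIntegral_le_lintegral _ _
  have hm_anti : Antitone m := antitone_setLIntegral_norm_ge _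
  have hWm : Measurable fun y => ‖W y‖ₑ ^ 2 := hW.enorm.measurable.pow_const _
  have hm_tend : Tendsto m atTop (𝓝 0) := tendsto_setLIntegral_norm_ge hWm hW2.ne
  set I : E → ℝ≥0∞ := fun x => ∫⁻ t in Ioo (0 : ℝ) 1, ENNReal.ofReal (t ^ k) * ‖W (t • x)‖ₑ
    with hI
  set J : E → ℝ≥0∞ := fun x => ∫⁻ t in Ioo (0 : ℝ) 1,
    ENNReal.ofReal (t ^ (2 * k + 1 / 2 : ℝ)) * ‖W (t • x)‖ₑ ^ 2 with hJ
  -- joint measurability of the integrands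
  have hWc : Continuous fun p : E × ℝ => W (p.2 • p.1) := hW.comp (continuous_snd.smul continuous_fst)
  have hJmeas : Measurable (uncurry fun (x : E) (t : ℝ) =>
      ENNReal.ofReal (t ^ (2 * k + 1 / 2 : ℝ)) * ‖W (t • x)‖ₑ ^ 2) := by
    refine Measurable.mul ?_ (hWc.enorm.measurable.pow_const _)
    exact ENNReal.measurable_ofReal.comp ((measurable_snd).pow_const _)
  -- Step 1: Cauchy–Schwarz in `t`
  have hCS : ∀ x, I x ^ 2 ≤ C₀ * J x := by
    intro x
    have hf : AEMeasurable (fun t : ℝ => ENNReal.ofReal (t ^ (-(1 / 4) : ℝ)))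
        (volume.restrict (Ioo (0 : ℝ) 1)) :=
      (ENNReal.measurable_ofReal.comp (measurable_id.pow_const _)).aemeasurable
    have hg : AEMeasurable (fun t : ℝ => ENNReal.ofReal (t ^ (k + 1 / 4 : ℝ)) * ‖W (t • x)‖ₑ)
        (volume.restrict (Ioo (0 : ℝ) 1)) :=
      ((ENNReal.measurable_ofReal.comp (measurable_id.pow_const _)).mul
        (hW.comp (continuous_id.smul continuous_const)).enorm.measurable).aemeasurable
    have h := lintegral_mul_sq_le hf hg
    have hIeq : I x = ∫⁻ t in Ioo (0 : ℝ) 1, ENNReal.ofReal (t ^ (-(1 / 4) : ℝ)) *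
        (ENNReal.ofReal (t ^ (k + 1 / 4 : ℝ)) * ‖W (t • x)‖ₑ) := by
      refine setLIntegral_congr_fun measurableSet_Ioo fun t ht => ?_
      rw [← mul_assoc, ← ENNReal.ofReal_mul (Real.rpow_nonneg ht.1.le _),
        ← Real.rpow_add ht.1, ← Real.rpow_natCast]
      norm_num
    have hfeq : ∫⁻ t in Ioo (0 : ℝ) 1, ENNReal.ofReal (t ^ (-(1 / 4) : ℝ)) ^ 2 = C₀ := by
      refine setLIntegral_congr_fun measurableSet_Ioo fun t ht => ?_
      rw [← ENNReal.ofReal_pow (Real.rpow_nonneg ht.1.le _), ← Real.rpow_natCast,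
        ← Real.rpow_mul ht.1.le]
      norm_num
    have hgeq : ∫⁻ t in Ioo (0 : ℝ) 1, (ENNReal.ofReal (t ^ (k + 1 / 4 : ℝ)) * ‖W (t • x)‖ₑ) ^ 2 =
        J x := by
      refine setLIntegral_congr_fun measurableSet_Ioo fun t ht => ?_
      have hexp : ((k : ℝ) + 1 / 4) * ((2 : ℕ) : ℝ) = 2 * k + 1 / 2 := by push_cast; ring
      rw [mul_pow, ← ENNReal.ofReal_pow (Real.rpow_nonneg ht.1.le _), ← Real.rpow_natCast,
        ← Real.rpow_mul ht.1.le, hexp]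
    rw [hIeq, ← hfeq, ← hgeq]
    exact h
  -- Step 2: the scaled tail identity, for `t ∈ (0,1)`
  have hscale : ∀ R : ℝ, ∀ t ∈ Ioo (0 : ℝ) 1,
      ∫⁻ x in {x | R ≤ ‖x‖}, ‖W (t • x)‖ₑ ^ 2 = ENNReal.ofReal ((t ^ 3)⁻¹) * m (t * R) := by
    intro R t ht
    have htpos : 0 < t := ht.1
    set G : E → ℝ≥0∞ := {y : E | t * R ≤ ‖y‖}.indicator fun y => ‖W y‖ₑ ^ 2 with hG
    have hGt : ∀ x, G (t • x) = {x : E | R ≤ ‖x‖}.indicator (fun x => ‖W (t • x)‖ₑ ^ 2) x := by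
      intro x
      have hiff : t • x ∈ {y : E | t * R ≤ ‖y‖} ↔ x ∈ {x : E | R ≤ ‖x‖} := by
        simp only [mem_setOf_eq, norm_smul, Real.norm_of_nonneg htpos.le]
        exact ⟨fun h => le_of_mul_le_mul_left h htpos, fun h => mul_le_mul_of_nonneg_left h htpos.le⟩
      by_cases hx : x ∈ {x : E | R ≤ ‖x‖}
      · rw [hG, indicator_of_mem (hiff.2 hx), indicator_of_mem hx]
      · rw [hG, indicator_of_notMem (fun h => hx (hiff.1 h)), indicator_of_notMem hx]
    rw [← lintegral_indicator (measurableSet_norm_ge R), hm]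
    simp only
    rw [← lintegral_indicator (measurableSet_norm_ge (t * R))]
    simp_rw [← hGt]
    rw [lintegral_comp_smul G htpos.ne', hE, abs_of_nonneg (inv_nonneg.2 (pow_nonneg htpos.le 3))]
  -- Step 3: the tail bound
  have htail : ∀ R : ℝ, ∫⁻ x in {x | R ≤ ‖x‖}, I x ^ 2 ≤
      C₀ * ∫⁻ t in Ioo (0 : ℝ) 1, ENNReal.ofReal (t ^ (-(1 / 2) : ℝ)) * m (t * R) := by
    intro R
    calc ∫⁻ x in {x | R ≤ ‖x‖}, I x ^ 2 ≤ ∫⁻ x in {x | R ≤ ‖x‖}, C₀ * J x :=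
          lintegral_mono fun x => hCS x
      _ = C₀ * ∫⁻ x in {x | R ≤ ‖x‖}, J x := by
          rw [lintegral_const_mul' _ _ hC₀fin.ne]
      _ = C₀ * ∫⁻ t in Ioo (0 : ℝ) 1, ∫⁻ x in {x | R ≤ ‖x‖},
            ENNReal.ofReal (t ^ (2 * k + 1 / 2 : ℝ)) * ‖W (t • x)‖ₑ ^ 2 := by
          congr 1
          exact lintegral_lintegral_swap (hJmeas.aemeasurable.mono_measure
            (Measure.prod_mono Measure.restrict_le_self Measure.restrict_le_self))
      _ = C₀ * ∫⁻ t in Ioo (0 : ℝ) 1,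
            ENNReal.ofReal (t ^ (2 * k + 1 / 2 : ℝ)) * (ENNReal.ofReal ((t ^ 3)⁻¹) * m (t * R)) := by
          congr 1
          refine setLIntegral_congr_fun measurableSet_Ioo fun t ht => ?_
          rw [lintegral_const_mul' _ _ ENNReal.ofReal_ne_top, hscale R t ht]
      _ ≤ C₀ * ∫⁻ t in Ioo (0 : ℝ) 1, ENNReal.ofReal (t ^ (-(1 / 2) : ℝ)) * m (t * R) := by
          refine mul_le_mul_right (setLIntegral_mono' measurableSet_Ioo fun t ht => ?_) C₀
          rw [← mul_assoc, ← ENNReal.ofReal_mul (Real.rpow_nonneg ht.1.le _)]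
          gcongr
          rw [← Real.rpow_natCast, ← Real.rpow_neg ht.1.le, ← Real.rpow_add ht.1]
          refine Real.rpow_le_rpow_of_exponent_ge ht.1 ht.2.le ?_
          push_cast
          have : (1 : ℝ) ≤ k := by exact_mod_cast hk
          linarith
  -- measurability of `I`
  have hImeas : Measurable I := by
    have : Measurable (uncurry fun (x : E) (t : ℝ) => ENNReal.ofReal (t ^ k) * ‖W (t • x)‖ₑ) :=
      (ENNReal.measurable_ofReal.comp (measurable_snd.pow_const _)).mul hWc.enorm.measurable
    exact this.lintegral_prod_right'
  refine ⟨?_, ?_⟩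
  · -- finiteness (`R = 0`: the whole space)
    have h0 : ∫⁻ x, I x ^ 2 = ∫⁻ x in {x : E | (0 : ℝ) ≤ ‖x‖}, I x ^ 2 := by
      rw [show {x : E | (0 : ℝ) ≤ ‖x‖} = univ from eq_univ_of_forall fun x => norm_nonneg x,
        Measure.restrict_univ]
    rw [h0]
    refine (htail 0).trans_lt ?_
    refine ENNReal.mul_lt_top hC₀fin ?_
    calc ∫⁻ t in Ioo (0 : ℝ) 1, ENNReal.ofReal (t ^ (-(1 / 2) : ℝ)) * m (t * 0)
        ≤ ∫⁻ t in Ioo (0 : ℝ) 1, ENNReal.ofReal (t ^ (-(1 / 2) : ℝ)) * M := by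
          gcongr; exact hm_le _
      _ < ⊤ := by
          rw [lintegral_mul_const' _ _ hW2.ne]
          exact ENNReal.mul_lt_top hC₀fin hW2
  · -- the limit `R → ∞`: dominated convergence in `t`
    have hlim : Tendsto (fun R : ℝ => ∫⁻ t in Ioo (0 : ℝ) 1,
        ENNReal.ofReal (t ^ (-(1 / 2) : ℝ)) * m (t * R)) atTop (𝓝 0) := by
      have h0 : (0 : ℝ≥0∞) = ∫⁻ _ in Ioo (0 : ℝ) 1, 0 := by simp
      rw [h0]
      refine tendsto_lintegral_filter_of_dominated_convergence
        (fun t => ENNReal.ofReal (t ^ (-(1 / 2) : ℝ)) * M) ?_ ?_ ?_ ?_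
      · filter_upwards [eventually_ge_atTop (0 : ℝ)] with R hR
        refine (ENNReal.measurable_ofReal.comp (measurable_id.pow_const _)).mul ?_
        have hanti : Antitone fun t : ℝ => m (t * R) := fun a b hab =>
          hm_anti (mul_le_mul_of_nonneg_right hab hR)
        exact hanti.measurable
      · exact Eventually.of_forall fun R => Eventually.of_forall fun t => by
          gcongr; exact hm_le _
      · rw [lintegral_mul_const' _ _ hW2.ne]
        exact (ENNReal.mul_lt_top hC₀fin hW2).ne
      · refine (ae_restrict_iff' measurableSet_Ioo).2 (Eventually.of_forall fun t ht => ?_)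
        have h1 : Tendsto (fun R : ℝ => m (t * R)) atTop (𝓝 0) :=
          hm_tend.comp (tendsto_id.const_mul_atTop ht.1)
        simpa using ENNReal.Tendsto.const_mul h1 (Or.inr ENNReal.ofReal_ne_top)
    have hlim' : Tendsto (fun R : ℝ => C₀ * ∫⁻ t in Ioo (0 : ℝ) 1,
        ENNReal.ofReal (t ^ (-(1 / 2) : ℝ)) * m (t * R)) atTop (𝓝 0) := by
      simpa using ENNReal.Tendsto.const_mul hlim (Or.inr hC₀fin.ne)
    exact tendsto_of_tendsto_of_tendsto_of_le_of_le tendsto_const_nhds hlim'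
      (fun _ => zero_le) htail

end Tail

/-! ### `H¹` convergence of the solenoidal truncation -/

section Estimates

variable [MeasurableSpace E] [BorelSpace E]
variable {V : E → E} {R : ℝ}

omit [MeasurableSpace E] [BorelSpace E] in
/-- `(a + b)² ≤ 4 (a² + b²)` in `ℝ≥0∞` (crude, via `a + b ≤ 2 max(a,b)`). [folklore] -/
theorem _root_.ENNReal.add_sq_le_four_mul (a b : ℝ≥0∞) : (a + b) ^ 2 ≤ 4 * (a ^ 2 + b ^ 2) := by
  have h1 : a + b ≤ 2 * max a b := by
    rw [two_mul]; exact add_le_add (le_max_left _ _) (le_max_right _ _)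
  have h2 : max a b ^ 2 ≤ a ^ 2 + b ^ 2 := by
    rcases le_total a b with h | h
    · rw [max_eq_right h]; exact le_add_self
    · rw [max_eq_left h]; exact le_self_add
  calc (a + b) ^ 2 ≤ (2 * max a b) ^ 2 := by gcongr
    _ = 4 * max a b ^ 2 := by ring
    _ ≤ 4 * (a ^ 2 + b ^ 2) := by gcongr

omit [FiniteDimensional ℝ E] [MeasurableSpace E] [BorelSpace E] in
/-- Inside the ball `‖x‖ < R` the solenoidal truncation coincides with `V` near `x`. [folklore] -/
theorem solenoidalTruncation_eventuallyEq (hR : 0 < R) {x : E} (hx : ‖x‖ < R) :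
    solenoidalTruncation V R =ᶠ[𝓝 x] V := by
  have hopen : IsOpen {y : E | ‖y‖ < R} := isOpen_lt continuous_norm continuous_const
  filter_upwards [hopen.mem_nhds hx] with y hy
  have h1 : cutoff (E := E) R y = 1 := cutoff_eq_one hR (le_of_lt hy)
  have h2 : fderiv ℝ (cutoff (E := E) R) y = 0 :=
    (fderiv_cutoff_eq_zero_of_not_mem hR (fun h => (not_lt.2 h.1) hy)).1
  simp [solenoidalTruncation, h1, h2]

omit [FiniteDimensional ℝ E] [MeasurableSpace E] [BorelSpace E] in
/-- **Pointwise bound for the truncation error**: with `‖D(cutoff R)‖ ≤ C₁/R`,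
`‖Ψ_R(x) - V(x)‖ ≤ ‖V(x)‖ + 4C₁ ‖F(x)‖` for all `x` (and `= 0` for `‖x‖ < R`): on the annulus
`R ≤ ‖x‖ ≤ 2R`, `|Dχ_R(x)[x]|, |Dχ_R(x)[F]| ‖x‖ ≤ (C₁/R)(2R)‖F‖`; off it `Dχ_R = 0`. [folklore] -/
theorem norm_solenoidalTruncation_sub_le {C₁ : ℝ} (hC₁ : 0 ≤ C₁)
    (hC : ∀ R : ℝ, 0 < R → ∀ x : E, ‖fderiv ℝ (cutoff (E := E) R) x‖ ≤ C₁ / R) (hR : 0 < R)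
    (x : E) :
    ‖solenoidalTruncation V R x - V x‖ ≤ ‖V x‖ + 4 * C₁ * ‖poincareField V x‖ := by
  set F := poincareField V x with hFdef
  set Dχ := fderiv ℝ (cutoff (E := E) R) x with hDχ
  have hdecomp : solenoidalTruncation V R x - V x =
      (cutoff R x - 1) • V x + (Dχ x) • F - (Dχ F) • x := by
    simp only [solenoidalTruncation, sub_smul, one_smul, ← hFdef, ← hDχ]; abel
  have hχ1 : ‖(cutoff R x - 1) • V x‖ ≤ ‖V x‖ := by
    rw [norm_smul]
    have : ‖cutoff (E := E) R x - 1‖ ≤ 1 := by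
      rw [Real.norm_eq_abs, abs_sub_comm, abs_of_nonneg (sub_nonneg.2 (cutoff_le_one R x))]
      linarith [cutoff_nonneg R x]
    calc ‖cutoff R x - 1‖ * ‖V x‖ ≤ 1 * ‖V x‖ := by gcongr
      _ = ‖V x‖ := one_mul _
  by_cases hA : R ≤ ‖x‖ ∧ ‖x‖ ≤ 2 * R
  · have hD : ‖Dχ‖ ≤ C₁ / R := hC R hR x
    have hDx : ‖Dχ‖ * ‖x‖ ≤ 2 * C₁ :=
      calc ‖Dχ‖ * ‖x‖ ≤ (C₁ / R) * (2 * R) := by gcongr; exact hA.2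
        _ = 2 * C₁ := by field_simp
    have h2 : ‖(Dχ x) • F‖ ≤ 2 * C₁ * ‖F‖ := by
      rw [norm_smul]
      gcongr
      exact (Dχ.le_opNorm x).trans hDx
    have h3 : ‖(Dχ F) • x‖ ≤ 2 * C₁ * ‖F‖ := by
      rw [norm_smul]
      calc ‖Dχ F‖ * ‖x‖ ≤ (‖Dχ‖ * ‖F‖) * ‖x‖ := by gcongr; exact Dχ.le_opNorm F
        _ = (‖Dχ‖ * ‖x‖) * ‖F‖ := by ring
        _ ≤ 2 * C₁ * ‖F‖ := by gcongr
    rw [hdecomp]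
    calc ‖(cutoff R x - 1) • V x + (Dχ x) • F - (Dχ F) • x‖
        ≤ ‖(cutoff R x - 1) • V x + (Dχ x) • F‖ + ‖(Dχ F) • x‖ := norm_sub_le _ _
      _ ≤ ‖(cutoff R x - 1) • V x‖ + ‖(Dχ x) • F‖ + ‖(Dχ F) • x‖ := by
          gcongr; exact norm_add_le _ _
      _ ≤ ‖V x‖ + 2 * C₁ * ‖F‖ + 2 * C₁ * ‖F‖ := by gcongr
      _ = ‖V x‖ + 4 * C₁ * ‖F‖ := by ring
  · have h0 : Dχ = 0 := (fderiv_cutoff_eq_zero_of_not_mem hR hA).1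
    rw [hdecomp, h0]
    simp only [_root_.zero_apply, zero_smul, add_zero, sub_zero]
    calc ‖(cutoff R x - 1) • V x‖ ≤ ‖V x‖ := hχ1
      _ ≤ ‖V x‖ + 4 * C₁ * ‖F‖ := le_add_of_nonneg_right (by positivity)

omit [MeasurableSpace E] [BorelSpace E] in
/-- **Pointwise bound for the derivative of the truncation error**: with `‖Dχ_R‖ ≤ C₁/R`,
`‖D²χ_R‖ ≤ C₂/R²`,
`‖DΨ_R(x) - DV(x)‖ ≤ ‖DV(x)‖ + (C₁/R)‖V(x)‖ + 4C₁‖DF(x)‖ + ((2C₁+4C₂)/R)‖F(x)‖`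
(Leibniz formula `hasFDerivAt_solenoidalTruncation`, all cut-off factors supported on the
annulus where `‖x‖ ≤ 2R`). [folklore] -/
theorem norm_fderiv_solenoidalTruncation_sub_le {C₁ C₂ : ℝ} (hC₁ : 0 ≤ C₁) (hC₂ : 0 ≤ C₂)
    (hC : ∀ R : ℝ, 0 < R → ∀ x : E, ‖fderiv ℝ (cutoff (E := E) R) x‖ ≤ C₁ / R)
    (hC' : ∀ R : ℝ, 0 < R → ∀ x : E, ‖fderiv ℝ (fderiv ℝ (cutoff (E := E) R)) x‖ ≤ C₂ / R ^ 2)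
    (hV : ContDiff ℝ 1 V) (hR : 0 < R) (x : E) :
    ‖fderiv ℝ (solenoidalTruncation V R) x - fderiv ℝ V x‖ ≤
      ‖fderiv ℝ V x‖ + C₁ / R * ‖V x‖ + 4 * C₁ * ‖fderiv ℝ (poincareField V) x‖ +
        (2 * C₁ + 4 * C₂) / R * ‖poincareField V x‖ := by
  rw [(hasFDerivAt_solenoidalTruncation hV R x).fderiv]
  set F := poincareField V x with hFdef
  set DF := fderiv ℝ (poincareField V) x with hDFdef
  set Dχ := fderiv ℝ (cutoff (E := E) R) x with hDχ
  set D2 := fderiv ℝ (fderiv ℝ (cutoff (E := E) R)) x with hD2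
  set DV := fderiv ℝ V x with hDV
  set χ := cutoff (E := E) R x with hχ
  have hdecomp : χ • DV + Dχ.smulRight (V x) +
      ((Dχ x) • DF + (Dχ.comp (ContinuousLinearMap.id ℝ E) + D2.flip x).smulRight F) -
      ((Dχ F) • ContinuousLinearMap.id ℝ E + (Dχ.comp DF + D2.flip F).smulRight x) - DV =
      (χ - 1) • DV + Dχ.smulRight (V x) +
      ((Dχ x) • DF + (Dχ + D2.flip x).smulRight F) -
      ((Dχ F) • ContinuousLinearMap.id ℝ E + (Dχ.comp DF + D2.flip F).smulRight x) := by
    simp only [sub_smul, one_smul, ContinuousLinearMap.comp_id]; abel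
  rw [hdecomp]
  have hχ1 : ‖(χ - 1) • DV‖ ≤ ‖DV‖ := by
    rw [norm_smul]
    have : ‖χ - 1‖ ≤ 1 := by
      rw [Real.norm_eq_abs, abs_sub_comm, abs_of_nonneg (sub_nonneg.2 (cutoff_le_one R x))]
      linarith [cutoff_nonneg R x]
    calc ‖χ - 1‖ * ‖DV‖ ≤ 1 * ‖DV‖ := by gcongr
      _ = ‖DV‖ := one_mul _
  have hRHS : ‖DV‖ ≤ ‖DV‖ + C₁ / R * ‖V x‖ + 4 * C₁ * ‖DF‖ + (2 * C₁ + 4 * C₂) / R * ‖F‖ := by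
    have h1 : 0 ≤ C₁ / R * ‖V x‖ := by positivity
    have h2 : 0 ≤ 4 * C₁ * ‖DF‖ := by positivity
    have h3 : 0 ≤ (2 * C₁ + 4 * C₂) / R * ‖F‖ := by positivity
    linarith
  by_cases hA : R ≤ ‖x‖ ∧ ‖x‖ ≤ 2 * R
  · have hD : ‖Dχ‖ ≤ C₁ / R := hC R hR x
    have hD2' : ‖D2‖ ≤ C₂ / R ^ 2 := hC' R hR x
    have hx2 : ‖x‖ ≤ 2 * R := hA.2
    have hDx : ‖Dχ‖ * ‖x‖ ≤ 2 * C₁ :=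
      calc ‖Dχ‖ * ‖x‖ ≤ (C₁ / R) * (2 * R) := by gcongr
        _ = 2 * C₁ := by field_simp
    have hD2x : ‖D2‖ * ‖x‖ ≤ 2 * C₂ / R :=
      calc ‖D2‖ * ‖x‖ ≤ (C₂ / R ^ 2) * (2 * R) := by gcongr
        _ = 2 * C₂ / R := by field_simp
    have hflip : ∀ y : E, ‖D2.flip y‖ ≤ ‖D2‖ * ‖y‖ := fun y => by
      have := D2.flip.le_opNorm y
      rwa [ContinuousLinearMap.opNorm_flip] at this
    -- the six terms
    have t2 : ‖Dχ.smulRight (V x)‖ ≤ C₁ / R * ‖V x‖ := by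
      rw [ContinuousLinearMap.norm_smulRight_apply]; gcongr
    have t3 : ‖(Dχ x) • DF‖ ≤ 2 * C₁ * ‖DF‖ := by
      rw [norm_smul]; gcongr; exact (Dχ.le_opNorm x).trans hDx
    have t4 : ‖(Dχ + D2.flip x).smulRight F‖ ≤ (C₁ + 2 * C₂) / R * ‖F‖ := by
      rw [ContinuousLinearMap.norm_smulRight_apply]
      gcongr
      calc ‖Dχ + D2.flip x‖ ≤ ‖Dχ‖ + ‖D2.flip x‖ := norm_add_le _ _
        _ ≤ C₁ / R + 2 * C₂ / R := add_le_add hD ((hflip x).trans hD2x)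
        _ = (C₁ + 2 * C₂) / R := by ring
    have t5 : ‖(Dχ F) • ContinuousLinearMap.id ℝ E‖ ≤ C₁ / R * ‖F‖ := by
      refine (norm_smul_le (Dχ F) (ContinuousLinearMap.id ℝ E)).trans ?_
      calc ‖Dχ F‖ * ‖ContinuousLinearMap.id ℝ E‖ ≤ ‖Dχ F‖ * 1 := by
            gcongr; exact ContinuousLinearMap.norm_id_le
        _ = ‖Dχ F‖ := mul_one _
        _ ≤ ‖Dχ‖ * ‖F‖ := Dχ.le_opNorm F
        _ ≤ C₁ / R * ‖F‖ := by gcongr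
    have t6 : ‖(Dχ.comp DF + D2.flip F).smulRight x‖ ≤ 2 * C₁ * ‖DF‖ + 2 * C₂ / R * ‖F‖ := by
      rw [ContinuousLinearMap.norm_smulRight_apply]
      calc ‖Dχ.comp DF + D2.flip F‖ * ‖x‖ ≤ (‖Dχ‖ * ‖DF‖ + ‖D2‖ * ‖F‖) * ‖x‖ := by
            gcongr
            exact (norm_add_le _ _).trans (add_le_add (Dχ.opNorm_comp_le DF) (hflip F))
        _ = (‖Dχ‖ * ‖x‖) * ‖DF‖ + (‖D2‖ * ‖x‖) * ‖F‖ := by ring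
        _ ≤ 2 * C₁ * ‖DF‖ + 2 * C₂ / R * ‖F‖ := by gcongr
    calc ‖(χ - 1) • DV + Dχ.smulRight (V x) + ((Dχ x) • DF + (Dχ + D2.flip x).smulRight F) -
          ((Dχ F) • ContinuousLinearMap.id ℝ E + (Dχ.comp DF + D2.flip F).smulRight x)‖
        ≤ ‖(χ - 1) • DV + Dχ.smulRight (V x) + ((Dχ x) • DF + (Dχ + D2.flip x).smulRight F)‖ +
          ‖(Dχ F) • ContinuousLinearMap.id ℝ E + (Dχ.comp DF + D2.flip F).smulRight x‖ :=
          norm_sub_le _ _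
      _ ≤ (‖(χ - 1) • DV‖ + ‖Dχ.smulRight (V x)‖ + (‖(Dχ x) • DF‖ + ‖(Dχ + D2.flip x).smulRight F‖)) +
          (‖(Dχ F) • ContinuousLinearMap.id ℝ E‖ + ‖(Dχ.comp DF + D2.flip F).smulRight x‖) := by
          gcongr
          · exact (norm_add_le _ _).trans (add_le_add (norm_add_le _ _) (norm_add_le _ _))
          · exact norm_add_le _ _
      _ ≤ (‖DV‖ + C₁ / R * ‖V x‖ + (2 * C₁ * ‖DF‖ + (C₁ + 2 * C₂) / R * ‖F‖)) +
          (C₁ / R * ‖F‖ + (2 * C₁ * ‖DF‖ + 2 * C₂ / R * ‖F‖)) := by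
          gcongr
      _ = ‖DV‖ + C₁ / R * ‖V x‖ + 4 * C₁ * ‖DF‖ + (2 * C₁ + 4 * C₂) / R * ‖F‖ := by ring
  · have h0 : Dχ = 0 := (fderiv_cutoff_eq_zero_of_not_mem hR hA).1
    have h0' : D2 = 0 := (fderiv_cutoff_eq_zero_of_not_mem hR hA).2
    have hz : ∀ v : E, (0 : E →L[ℝ] ℝ).smulRight v = 0 := fun v => by ext w; simp
    rw [h0, h0']
    simp only [_root_.zero_apply, zero_smul, add_zero, ContinuousLinearMap.flip_zero,
      ContinuousLinearMap.zero_comp, hz, sub_zero]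
    exact hχ1.trans hRHS

variable {F' : Type*} [NormedAddCommGroup F']

omit [FiniteDimensional ℝ E] in
/-- Ray averages `x ↦ ∫₀¹ tᵏ ‖W(tx)‖ dt` of a continuous field are measurable. [folklore] -/
theorem measurable_rayAverage {W : E → F'} (hW : Continuous W) (k : ℕ) :
    Measurable fun x => ∫⁻ t in Ioo (0 : ℝ) 1, ENNReal.ofReal (t ^ k) * ‖W (t • x)‖ₑ := by
  have hWc : Continuous fun p : E × ℝ => W (p.2 • p.1) :=
    hW.comp (continuous_snd.smul continuous_fst)
  have : Measurable (uncurry fun (x : E) (t : ℝ) => ENNReal.ofReal (t ^ k) * ‖W (t • x)‖ₑ) :=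
    (ENNReal.measurable_ofReal.comp (measurable_snd.pow_const _)).mul hWc.enorm.measurable
  exact this.lintegral_prod_right'

omit [FiniteDimensional ℝ E] [MeasurableSpace E] [BorelSpace E] in
/-- `‖F(x)‖ ≤ ∫₀¹ t ‖V(tx)‖ dt`. [folklore] -/
theorem enorm_poincareField_le (x : E) :
    ‖poincareField V x‖ₑ ≤ ∫⁻ t in Ioo (0 : ℝ) 1, ENNReal.ofReal (t ^ 1) * ‖V (t • x)‖ₑ := by
  rw [poincareField, intervalIntegral.integral_of_le zero_le_one, ← restrict_Ioo_eq_restrict_Ioc]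
  refine (enorm_integral_le_lintegral_enorm _).trans (le_of_eq ?_)
  refine setLIntegral_congr_fun measurableSet_Ioo fun t ht => ?_
  rw [enorm_smul, Real.enorm_eq_ofReal ht.1.le, pow_one]

omit [MeasurableSpace E] [BorelSpace E] in
/-- `‖DF(x)‖ ≤ ∫₀¹ t² ‖DV(tx)‖ dt`. [folklore] -/
theorem enorm_fderiv_poincareField_le (hV : ContDiff ℝ 1 V) (x : E) :
    ‖fderiv ℝ (poincareField V) x‖ₑ ≤
      ∫⁻ t in Ioo (0 : ℝ) 1, ENNReal.ofReal (t ^ 2) * ‖fderiv ℝ V (t • x)‖ₑ := by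
  rw [fderiv_poincareField hV, intervalIntegral.integral_of_le zero_le_one,
    ← restrict_Ioo_eq_restrict_Ioc]
  refine (enorm_integral_le_lintegral_enorm _).trans (le_of_eq ?_)
  refine setLIntegral_congr_fun measurableSet_Ioo fun t ht => ?_
  rw [enorm_smul, Real.enorm_eq_ofReal (pow_nonneg ht.1.le 2)]

omit [MeasurableSpace E] [BorelSpace E] in
/-- Real-to-extended conversion of a bound `‖a‖ ≤ ‖b‖ + c ‖d‖` (`c ≥ 0`). [folklore] -/
theorem enorm_le_of_norm_le_add_mul {A B D : Type*} [SeminormedAddCommGroup A]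
    [SeminormedAddCommGroup B] [SeminormedAddCommGroup D] {a : A} {b : B} {d : D} {c : ℝ}
    (hc : 0 ≤ c) (h : ‖a‖ ≤ ‖b‖ + c * ‖d‖) :
    ‖a‖ₑ ≤ ‖b‖ₑ + ENNReal.ofReal c * ‖d‖ₑ := by
  rw [← ofReal_norm, ← ofReal_norm b, ← ofReal_norm d,
    ← ENNReal.ofReal_mul hc, ← ENNReal.ofReal_add (norm_nonneg _) (by positivity)]
  exact ENNReal.ofReal_le_ofReal h

omit [MeasurableSpace E] [BorelSpace E] in
/-- Real-to-extended conversion of a four-term bound (nonnegative coefficients). [folklore] -/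
theorem enorm_le_of_norm_le_add₄ {A B B₁ B₂ B₃ : Type*} [SeminormedAddCommGroup A]
    [SeminormedAddCommGroup B] [SeminormedAddCommGroup B₁] [SeminormedAddCommGroup B₂]
    [SeminormedAddCommGroup B₃] {a : A} {b : B} {v : B₁} {w : B₂} {z : B₃} {p q r : ℝ}
    (hp : 0 ≤ p) (hq : 0 ≤ q) (hr : 0 ≤ r) (h : ‖a‖ ≤ ‖b‖ + p * ‖v‖ + q * ‖w‖ + r * ‖z‖) :
    ‖a‖ₑ ≤ ‖b‖ₑ + ENNReal.ofReal p * ‖v‖ₑ + ENNReal.ofReal q * ‖w‖ₑ + ENNReal.ofReal r * ‖z‖ₑ := by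
  rw [← ofReal_norm, ← ofReal_norm b, ← ofReal_norm v, ← ofReal_norm w, ← ofReal_norm z,
    ← ENNReal.ofReal_mul hp, ← ENNReal.ofReal_mul hq, ← ENNReal.ofReal_mul hr,
    ← ENNReal.ofReal_add (norm_nonneg _) (by positivity),
    ← ENNReal.ofReal_add (by positivity) (by positivity),
    ← ENNReal.ofReal_add (by positivity) (by positivity)]
  exact ENNReal.ofReal_le_ofReal h

/-- **`H¹` convergence of the solenoidal truncation** (dimension `3`). For `V ∈ C¹` with
`V, DV ∈ L²`: `‖Ψ_R - V‖_{L²} → 0` and `‖DΨ_R - DV‖_{L²} → 0` as `R → ∞` (squared `L²` norms as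
lower integrals). Proof: `Ψ_R = V` on `‖x‖ < R`; on `‖x‖ ≥ R` the pointwise bounds
`norm_solenoidalTruncation_sub_le`, `norm_fderiv_solenoidalTruncation_sub_le` reduce everything
to the tails of `V`, `DV` in `L²`, the factors `R⁻¹`, and the `L²` tails of the ray averages
dominating `F`, `DF` (`lintegral_sq_rayAverage`). [folklore] -/
theorem tendsto_lintegral_solenoidalTruncation_sub (hE : finrank ℝ E = 3) (hV : ContDiff ℝ 1 V)
    (hV2 : ∫⁻ x, ‖V x‖ₑ ^ 2 < ⊤) (hDV2 : ∫⁻ x, ‖fderiv ℝ V x‖ₑ ^ 2 < ⊤) :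
    Tendsto (fun R : ℝ => ∫⁻ x, ‖solenoidalTruncation V R x - V x‖ₑ ^ 2) atTop (𝓝 0) ∧
    Tendsto (fun R : ℝ => ∫⁻ x, ‖fderiv ℝ (solenoidalTruncation V R) x - fderiv ℝ V x‖ₑ ^ 2)
      atTop (𝓝 0) := by
  obtain ⟨C₁, hC₁, hC⟩ := exists_norm_fderiv_cutoff_le (E := E)
  obtain ⟨C₂, hC₂, hC'⟩ := exists_norm_fderiv_fderiv_cutoff_le (E := E)
  have hVc : Continuous V := hV.continuous
  have hDVc : Continuous (fderiv ℝ V) := hV.continuous_fderiv one_ne_zero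
  set I₁ : E → ℝ≥0∞ := fun x => ∫⁻ t in Ioo (0 : ℝ) 1, ENNReal.ofReal (t ^ 1) * ‖V (t • x)‖ₑ
    with hI₁
  set I₂ : E → ℝ≥0∞ := fun x =>
    ∫⁻ t in Ioo (0 : ℝ) 1, ENNReal.ofReal (t ^ 2) * ‖fderiv ℝ V (t • x)‖ₑ with hI₂
  have hI₁m : Measurable I₁ := measurable_rayAverage hVc 1
  have hI₂m : Measurable I₂ := measurable_rayAverage hDVc 2
  obtain ⟨hA₁, hT₁⟩ := lintegral_sq_rayAverage hE hVc hV2 (k := 1) le_rfl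
  obtain ⟨-, hT₂⟩ := lintegral_sq_rayAverage hE hDVc hDV2 (k := 2) one_le_two
  have hF : ∀ x, ‖poincareField V x‖ₑ ≤ I₁ x := fun x => enorm_poincareField_le x
  have hDF : ∀ x, ‖fderiv ℝ (poincareField V) x‖ₑ ≤ I₂ x := fun x =>
    enorm_fderiv_poincareField_le hV x
  have hVm : Measurable fun x => ‖V x‖ₑ ^ 2 := hVc.enorm.measurable.pow_const 2
  have hDVm : Measurable fun x => ‖fderiv ℝ V x‖ₑ ^ 2 := hDVc.enorm.measurable.pow_const 2
  have htV := tendsto_setLIntegral_norm_ge (μ := volume) hVm hV2.ne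
  have htDV := tendsto_setLIntegral_norm_ge (μ := volume) hDVm hDV2.ne
  set S : ℝ → Set E := fun R => {x | R ≤ ‖x‖} with hS
  have hSm : ∀ R, MeasurableSet (S R) := fun R => measurableSet_norm_ge R
  -- the vanishing factor `ofReal (c / R) ^ 2`
  have hinv : ∀ c : ℝ, Tendsto (fun R : ℝ => ENNReal.ofReal (c / R) ^ 2) atTop (𝓝 0) := by
    intro c
    have h1 : Tendsto (fun R : ℝ => c / R) atTop (𝓝 0) := tendsto_const_nhds.div_atTop tendsto_id
    have h2 := ENNReal.Tendsto.pow (n := 2) (ENNReal.tendsto_ofReal h1)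
    simpa using h2
  refine ⟨?_, ?_⟩
  · -- Part 1: the fields
    set c : ℝ≥0∞ := ENNReal.ofReal (4 * C₁) with hc
    have hpt : ∀ R, 0 < R → ∀ x, ‖solenoidalTruncation V R x - V x‖ₑ ^ 2 ≤
        (S R).indicator (fun x => 4 * (‖V x‖ₑ ^ 2 + c ^ 2 * I₁ x ^ 2)) x := by
      intro R hR x
      by_cases hx : x ∈ S R
      · rw [indicator_of_mem hx]
        have h1 : ‖solenoidalTruncation V R x - V x‖ₑ ≤ ‖V x‖ₑ + c * I₁ x :=
          calc ‖solenoidalTruncation V R x - V x‖ₑ ≤ ‖V x‖ₑ + c * ‖poincareField V x‖ₑ :=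
                enorm_le_of_norm_le_add_mul (by positivity)
                  (norm_solenoidalTruncation_sub_le hC₁ hC hR x)
            _ ≤ ‖V x‖ₑ + c * I₁ x := by gcongr; exact hF x
        calc ‖solenoidalTruncation V R x - V x‖ₑ ^ 2 ≤ (‖V x‖ₑ + c * I₁ x) ^ 2 := by gcongr
          _ ≤ 4 * (‖V x‖ₑ ^ 2 + (c * I₁ x) ^ 2) := ENNReal.add_sq_le_four_mul _ _
          _ = 4 * (‖V x‖ₑ ^ 2 + c ^ 2 * I₁ x ^ 2) := by rw [mul_pow]
      · have hxR : ‖x‖ < R := not_le.1 hx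
        rw [indicator_of_notMem hx, (solenoidalTruncation_eventuallyEq hR hxR).eq_of_nhds,
          sub_self]
        simp
    have hbound : ∀ R, 0 < R → ∫⁻ x, ‖solenoidalTruncation V R x - V x‖ₑ ^ 2 ≤
        4 * ((∫⁻ x in S R, ‖V x‖ₑ ^ 2) + c ^ 2 * ∫⁻ x in S R, I₁ x ^ 2) := by
      intro R hR
      calc ∫⁻ x, ‖solenoidalTruncation V R x - V x‖ₑ ^ 2
          ≤ ∫⁻ x, (S R).indicator (fun x => 4 * (‖V x‖ₑ ^ 2 + c ^ 2 * I₁ x ^ 2)) x :=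
            lintegral_mono (hpt R hR)
        _ = 4 * ((∫⁻ x in S R, ‖V x‖ₑ ^ 2) + c ^ 2 * ∫⁻ x in S R, I₁ x ^ 2) := by
            rw [lintegral_indicator (hSm R), lintegral_const_mul' _ _ (by norm_num),
              lintegral_add_left hVm, lintegral_const_mul' _ _ (ENNReal.pow_ne_top ENNReal.ofReal_ne_top)]
    have hlim : Tendsto (fun R => 4 * ((∫⁻ x in S R, ‖V x‖ₑ ^ 2) + c ^ 2 * ∫⁻ x in S R, I₁ x ^ 2))
        atTop (𝓝 0) := by
      have h1 : Tendsto (fun R => c ^ 2 * ∫⁻ x in S R, I₁ x ^ 2) atTop (𝓝 0) := by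
        have := ENNReal.Tendsto.const_mul hT₁
          (Or.inr (ENNReal.pow_ne_top ENNReal.ofReal_ne_top) : (0 : ℝ≥0∞) ≠ 0 ∨ c ^ 2 ≠ ⊤)
        rw [mul_zero] at this
        exact this
      have h2 := htV.add h1
      rw [add_zero] at h2
      have h3 := ENNReal.Tendsto.const_mul h2 (Or.inr (by norm_num) : (0 : ℝ≥0∞) ≠ 0 ∨ (4 : ℝ≥0∞) ≠ ⊤)
      rw [mul_zero] at h3
      exact h3
    refine tendsto_of_tendsto_of_tendsto_of_le_of_le' tendsto_const_nhds hlim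
      (Eventually.of_forall fun R => zero_le) ?_
    filter_upwards [eventually_gt_atTop (0 : ℝ)] with R hR using hbound R hR
  · -- Part 2: the derivatives
    set c : ℝ≥0∞ := ENNReal.ofReal (4 * C₁) with hc
    set b : ℝ → ℝ≥0∞ := fun R => ENNReal.ofReal (C₁ / R) with hb
    set d : ℝ → ℝ≥0∞ := fun R => ENNReal.ofReal ((2 * C₁ + 4 * C₂) / R) with hd
    have hpt : ∀ R, 0 < R → ∀ x,
        ‖fderiv ℝ (solenoidalTruncation V R) x - fderiv ℝ V x‖ₑ ^ 2 ≤
        (S R).indicator (fun x => 16 * (‖fderiv ℝ V x‖ₑ ^ 2 + b R ^ 2 * ‖V x‖ₑ ^ 2 +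
          c ^ 2 * I₂ x ^ 2 + d R ^ 2 * I₁ x ^ 2)) x := by
      intro R hR x
      by_cases hx : x ∈ S R
      · rw [indicator_of_mem hx]
        have h0 := norm_fderiv_solenoidalTruncation_sub_le hC₁ hC₂ hC hC' hV hR x
        have h1 : ‖fderiv ℝ (solenoidalTruncation V R) x - fderiv ℝ V x‖ₑ ≤
            (‖fderiv ℝ V x‖ₑ + b R * ‖V x‖ₑ) + (c * I₂ x + d R * I₁ x) := by
          have h2 := enorm_le_of_norm_le_add₄ (by positivity) (by positivity) (by positivity) h0
          calc ‖fderiv ℝ (solenoidalTruncation V R) x - fderiv ℝ V x‖ₑ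
              ≤ ‖fderiv ℝ V x‖ₑ + b R * ‖V x‖ₑ + c * ‖fderiv ℝ (poincareField V) x‖ₑ +
                  d R * ‖poincareField V x‖ₑ := h2
            _ ≤ ‖fderiv ℝ V x‖ₑ + b R * ‖V x‖ₑ + c * I₂ x + d R * I₁ x := by
                gcongr
                · exact hDF x
                · exact hF x
            _ = (‖fderiv ℝ V x‖ₑ + b R * ‖V x‖ₑ) + (c * I₂ x + d R * I₁ x) := by ring
        calc ‖fderiv ℝ (solenoidalTruncation V R) x - fderiv ℝ V x‖ₑ ^ 2
            ≤ ((‖fderiv ℝ V x‖ₑ + b R * ‖V x‖ₑ) + (c * I₂ x + d R * I₁ x)) ^ 2 := by gcongr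
          _ ≤ 4 * ((‖fderiv ℝ V x‖ₑ + b R * ‖V x‖ₑ) ^ 2 + (c * I₂ x + d R * I₁ x) ^ 2) :=
              ENNReal.add_sq_le_four_mul _ _
          _ ≤ 4 * (4 * (‖fderiv ℝ V x‖ₑ ^ 2 + (b R * ‖V x‖ₑ) ^ 2) +
                4 * ((c * I₂ x) ^ 2 + (d R * I₁ x) ^ 2)) := by
              gcongr <;> exact ENNReal.add_sq_le_four_mul _ _
          _ = 16 * (‖fderiv ℝ V x‖ₑ ^ 2 + b R ^ 2 * ‖V x‖ₑ ^ 2 + c ^ 2 * I₂ x ^ 2 +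
                d R ^ 2 * I₁ x ^ 2) := by
              rw [mul_pow, mul_pow, mul_pow]; ring
      · have hxR : ‖x‖ < R := not_le.1 hx
        rw [indicator_of_notMem hx, (solenoidalTruncation_eventuallyEq hR hxR).fderiv_eq, sub_self]
        simp
    have hbound : ∀ R, 0 < R →
        ∫⁻ x, ‖fderiv ℝ (solenoidalTruncation V R) x - fderiv ℝ V x‖ₑ ^ 2 ≤
        16 * ((∫⁻ x in S R, ‖fderiv ℝ V x‖ₑ ^ 2) + b R ^ 2 * (∫⁻ x, ‖V x‖ₑ ^ 2) +
          c ^ 2 * (∫⁻ x in S R, I₂ x ^ 2) + d R ^ 2 * ∫⁻ x, I₁ x ^ 2) := by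
      intro R hR
      have hm0 : Measurable fun x => ‖fderiv ℝ V x‖ₑ ^ 2 + b R ^ 2 * ‖V x‖ₑ ^ 2 :=
        Measurable.add hDVm (hVm.const_mul _)
      have hm1 : Measurable fun x => ‖fderiv ℝ V x‖ₑ ^ 2 + b R ^ 2 * ‖V x‖ₑ ^ 2 +
          c ^ 2 * I₂ x ^ 2 :=
        Measurable.add hm0 ((hI₂m.pow_const 2).const_mul _)
      calc ∫⁻ x, ‖fderiv ℝ (solenoidalTruncation V R) x - fderiv ℝ V x‖ₑ ^ 2
          ≤ ∫⁻ x, (S R).indicator (fun x => 16 * (‖fderiv ℝ V x‖ₑ ^ 2 + b R ^ 2 * ‖V x‖ₑ ^ 2 +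
              c ^ 2 * I₂ x ^ 2 + d R ^ 2 * I₁ x ^ 2)) x := lintegral_mono (hpt R hR)
        _ = 16 * ((∫⁻ x in S R, ‖fderiv ℝ V x‖ₑ ^ 2) + b R ^ 2 * (∫⁻ x in S R, ‖V x‖ₑ ^ 2) +
              c ^ 2 * (∫⁻ x in S R, I₂ x ^ 2) + d R ^ 2 * ∫⁻ x in S R, I₁ x ^ 2) := by
            rw [lintegral_indicator (hSm R), lintegral_const_mul' _ _ (by norm_num),
              lintegral_add_left hm1, lintegral_add_left hm0,
              lintegral_add_left hDVm,
              lintegral_const_mul' _ _ (ENNReal.pow_ne_top ENNReal.ofReal_ne_top),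
              lintegral_const_mul' _ _ (ENNReal.pow_ne_top ENNReal.ofReal_ne_top),
              lintegral_const_mul' _ _ (ENNReal.pow_ne_top ENNReal.ofReal_ne_top)]
        _ ≤ 16 * ((∫⁻ x in S R, ‖fderiv ℝ V x‖ₑ ^ 2) + b R ^ 2 * (∫⁻ x, ‖V x‖ₑ ^ 2) +
              c ^ 2 * (∫⁻ x in S R, I₂ x ^ 2) + d R ^ 2 * ∫⁻ x, I₁ x ^ 2) := by
            gcongr <;> exact Measure.restrict_le_self
    have hlim : Tendsto (fun R => 16 * ((∫⁻ x in S R, ‖fderiv ℝ V x‖ₑ ^ 2) +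
        b R ^ 2 * (∫⁻ x, ‖V x‖ₑ ^ 2) + c ^ 2 * (∫⁻ x in S R, I₂ x ^ 2) +
        d R ^ 2 * ∫⁻ x, I₁ x ^ 2)) atTop (𝓝 0) := by
      have h1 : Tendsto (fun R => b R ^ 2 * ∫⁻ x, ‖V x‖ₑ ^ 2) atTop (𝓝 0) := by
        have := ENNReal.Tendsto.mul_const (hinv C₁) (Or.inr hV2.ne)
        rw [zero_mul] at this
        exact this
      have h2 : Tendsto (fun R => c ^ 2 * ∫⁻ x in S R, I₂ x ^ 2) atTop (𝓝 0) := by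
        have := ENNReal.Tendsto.const_mul hT₂
          (Or.inr (ENNReal.pow_ne_top ENNReal.ofReal_ne_top) : (0 : ℝ≥0∞) ≠ 0 ∨ c ^ 2 ≠ ⊤)
        rw [mul_zero] at this
        exact this
      have h3 : Tendsto (fun R => d R ^ 2 * ∫⁻ x, I₁ x ^ 2) atTop (𝓝 0) := by
        have := ENNReal.Tendsto.mul_const (hinv (2 * C₁ + 4 * C₂)) (Or.inr hA₁.ne)
        rw [zero_mul] at this
        exact this
      have h4 := ((htDV.add h1).add h2).add h3
      rw [add_zero, add_zero, add_zero] at h4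
      have h5 := ENNReal.Tendsto.const_mul h4 (Or.inr (by norm_num) : (0 : ℝ≥0∞) ≠ 0 ∨ (16 : ℝ≥0∞) ≠ ⊤)
      rw [mul_zero] at h5
      exact h5
    refine tendsto_of_tendsto_of_tendsto_of_le_of_le' tendsto_const_nhds hlim
      (Eventually.of_forall fun R => zero_le) ?_
    filter_upwards [eventually_gt_atTop (0 : ℝ)] with R hR using hbound R hR

end Estimates

/-! ### Density of divergence-free test fields in `H¹_σ` -/

section Density

variable [MeasurableSpace E] [BorelSpace E]

/-- **A weakly divergence-free field with a weak gradient has traceless gradient a.e.**: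
testing `∫ ⟪Ψ, ∇θ⟫ = 0` and `∫ (∂ᵢθ) Ψ = -∫ θ G eᵢ` gives `∫ θ tr G = 0` for every test `θ`. [folklore] -/
theorem ae_traceCLM_eq_zero_of_isWeaklyDivFree {Ψ : E → E} {G : E → E →L[ℝ] E}
    (hG : HasWeakGradient Ψ G) (hdiv : IsWeaklyDivFree Ψ) :
    ∀ᵐ x ∂(volume : Measure E), traceCLM (G x) = 0 := by
  haveI : CompleteSpace E := FiniteDimensional.complete ℝ E
  set b := stdOrthonormalBasis ℝ E with hb
  have hΨloc : LocallyIntegrable Ψ volume := locallyIntegrableOn_univ.1 (by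
    simpa only [Opens.coe_top] using hG.locallyIntegrableOn)
  have hGloc : LocallyIntegrable G volume := locallyIntegrableOn_univ.1 (by
    simpa only [Opens.coe_top] using hG.locallyIntegrableOn_deriv)
  have hGi : ∀ i, LocallyIntegrable (fun y => G y (b i)) volume := fun i =>
    locallyIntegrableOn_univ.1
      ((ContinuousLinearMap.apply ℝ E (b i)).locallyIntegrableOn_comp
        (locallyIntegrableOn_univ.2 hGloc))
  have htr : LocallyIntegrable (fun y => traceCLM (G y)) volume :=
    locallyIntegrableOn_univ.1
      ((traceCLM (E := E)).locallyIntegrableOn_comp (locallyIntegrableOn_univ.2 hGloc))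
  refine ae_eq_zero_of_integral_contDiff_smul_eq_zero htr fun θ hθ hθc => ?_
  have hθtest : FunctionSpaces.IsTestFunctionOn (⊤ : Opens E) θ := ⟨hθ, hθc, by simp⟩
  have hθd : Differentiable ℝ θ := hθ.differentiable (by simp)
  -- integrability of the pieces
  have i1 : ∀ i, Integrable (fun x => θ x • G x (b i)) volume := fun i =>
    (hGi i).integrable_smul_left_of_hasCompactSupport hθ.continuous hθc
  have i2 : ∀ i, Integrable (fun x => (fderiv ℝ θ x (b i)) • Ψ x) volume := fun i =>
    hΨloc.integrable_smul_left_of_hasCompactSupport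
      ((hθ.continuous_fderiv (by simp)).clm_apply continuous_const) (hθc.fderiv_apply ℝ (b i))
  -- the weak-gradient identity, componentwise
  have hw : ∀ i, ∫ x, θ x • G x (b i) = -∫ x, (fderiv ℝ θ x (b i)) • Ψ x := by
    intro i
    have := hG.integral_fderiv_smul_eq θ (b i) hθtest
    simp only [Opens.coe_top, Measure.restrict_univ] at this
    rw [this, neg_neg]
  -- expand the trace
  have hexp : ∀ x, θ x • traceCLM (G x) = ∑ i, ⟪b i, θ x • G x (b i)⟫ := by
    intro x
    rw [traceCLM_eq_sum_inner b, smul_eq_mul, Finset.mul_sum]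
    refine Finset.sum_congr rfl fun i _ => ?_
    rw [real_inner_smul_right]
  simp_rw [hexp]
  rw [integral_finsetSum _ fun i _ => (i1 i).const_inner (𝕜 := ℝ) (b i)]
  have hstep : ∀ i, ∫ x, ⟪b i, θ x • G x (b i)⟫ = -∫ x, (fderiv ℝ θ x (b i)) * ⟪b i, Ψ x⟫ := by
    intro i
    rw [integral_inner (i1 i), hw i, inner_neg_right, ← integral_inner (i2 i)]
    congr 1
    refine integral_congr_ae (Eventually.of_forall fun x => ?_)
    simp only [real_inner_smul_right]
  simp_rw [hstep]
  rw [Finset.sum_neg_distrib, neg_eq_zero, ← integral_finsetSum _ fun i _ => ?_]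
  · have hgrad : ∀ x, ∑ i, (fderiv ℝ θ x (b i)) * ⟪b i, Ψ x⟫ = ⟪Ψ x, gradient θ x⟫ := by
      intro x
      have hrep : gradient θ x = ∑ i, (fderiv ℝ θ x (b i)) • b i := by
        conv_lhs => rw [← b.sum_repr' (gradient θ x)]
        refine Finset.sum_congr rfl fun i _ => ?_
        rw [gradient, real_inner_comm, InnerProductSpace.toDual_symm_apply]
      rw [hrep, inner_sum]
      refine Finset.sum_congr rfl fun i _ => ?_
      rw [real_inner_smul_right, real_inner_comm]
    simp_rw [hgrad]
    exact hdiv θ hθtest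
  · have : (fun x => (fderiv ℝ θ x (b i)) * ⟪b i, Ψ x⟫) = fun x => ⟪b i, (fderiv ℝ θ x (b i)) • Ψ x⟫ := by
      ext x; rw [real_inner_smul_right]
    rw [this]
    exact (i2 i).const_inner (𝕜 := ℝ) (b i)

/-- **Mollifications of weakly divergence-free fields are divergence free**:
`div(φ ⋆ Ψ)(x) = tr ∫ φ(t) G(x - t) dt = ∫ φ(t) tr G(x - t) dt = 0`. [folklore] -/
theorem isDivFree_normed_convolution {Ψ : E → E} {G : E → E →L[ℝ] E}
    (hG : HasWeakGradient Ψ G) (hdiv : IsWeaklyDivFree Ψ) (φ : ContDiffBump (0 : E)) :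
    VectorCalculus.IsDivFree (φ.normed volume ⋆[lsmul ℝ ℝ, volume] Ψ) := by
  intro x
  have hK : FunctionSpaces.IsTestFunctionOn (⊤ : Opens E) (φ.normed volume) := FunctionSpaces.isTestFunctionOn_normed φ
  have hGloc : LocallyIntegrable G volume := locallyIntegrableOn_univ.1 (by
    simpa only [Opens.coe_top] using hG.locallyIntegrableOn_deriv)
  -- integrability of `t ↦ φ(t) G(x - t)`
  have hint : Integrable (fun t => φ.normed volume t • G (x - t)) volume := by
    have hloc : LocallyIntegrable (fun t => G (x - t)) volume := by
      have hmap : Measure.map (Homeomorph.subLeft x) (volume : Measure E) = volume :=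
        Measure.map_sub_left_eq_self volume x
      have h := (locallyIntegrable_map_homeomorph (μ := volume) (Homeomorph.subLeft x)
        (f := G)).1 (by rw [hmap]; exact hGloc)
      simpa [Function.comp_def] using h
    exact hloc.integrable_smul_left_of_hasCompactSupport φ.continuous_normed
      φ.hasCompactSupport_normed
  -- the derivative of the mollification as a Bochner integral of linear maps
  have hD : fderiv ℝ (φ.normed volume ⋆[lsmul ℝ ℝ, volume] Ψ) x =
      ∫ t, φ.normed volume t • G (x - t) := by
    ext v
    rw [hG.fderiv_convolution_apply hK x v, ContinuousLinearMap.integral_apply hint v,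
      convolution_def]
    rfl
  rw [divergence_eq_traceCLM, hD, ← traceCLM.integral_comp_comm hint]
  have hae : ∀ᵐ t ∂(volume : Measure E), traceCLM (G (x - t)) = 0 :=
    (Measure.measurePreserving_sub_left volume x).quasiMeasurePreserving.ae
      (ae_traceCLM_eq_zero_of_isWeaklyDivFree hG hdiv)
  rw [MeasureTheory.integral_congr_ae (g := fun _ => (0 : ℝ)) ?_, integral_zero]
  filter_upwards [hae] with t ht
  rw [map_smul, ht, smul_zero]

omit [MeasurableSpace E] [BorelSpace E] in
/-- The Frobenius norm is dominated by the dimension times the operator norm: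
`|L|² = ∑ᵢ ‖L bᵢ‖² ≤ n ‖L‖²`. [folklore] -/
theorem ofReal_frobeniusNormSq_le_finrank_mul (L : E →L[ℝ] E) :
    ENNReal.ofReal (frobeniusNormSq L) ≤ (finrank ℝ E : ℝ≥0∞) * ‖L‖ₑ ^ 2 := by
  set b := stdOrthonormalBasis ℝ E with hb
  have h1 : frobeniusNormSq L ≤ finrank ℝ E * ‖L‖ ^ 2 := by
    rw [frobeniusNormSq_eq_sum b]
    calc ∑ i, ‖L (b i)‖ ^ 2 ≤ ∑ _i : Fin (finrank ℝ E), ‖L‖ ^ 2 := by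
          refine Finset.sum_le_sum fun i _ => ?_
          have := L.le_opNorm (b i)
          rw [b.orthonormal.1 i, mul_one] at this
          exact pow_le_pow_left₀ (norm_nonneg _) this 2
      _ = finrank ℝ E * ‖L‖ ^ 2 := by simp
  calc ENNReal.ofReal (frobeniusNormSq L) ≤ ENNReal.ofReal (finrank ℝ E * ‖L‖ ^ 2) :=
        ENNReal.ofReal_le_ofReal h1
    _ = (finrank ℝ E : ℝ≥0∞) * ‖L‖ₑ ^ 2 := by
        rw [ENNReal.ofReal_mul (by positivity), ENNReal.ofReal_natCast, ← ofReal_norm,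
          ENNReal.ofReal_pow (norm_nonneg _)]

/-- **Density of smooth compactly supported divergence-free fields in `H¹_σ(ℝ³)`.** Let
`dim E = 3` and let `Ψ ∈ L²(E; E)` be weakly divergence free with a weak gradient `G`,
`∫ |G|² < ∞`. Then for every `δ > 0` there is a divergence-free test field `Φ ∈ C_c^∞(E; E)`
(`IsTestFunctionOn ⊤ Φ`, `IsDivFree Φ`) with `‖Φ - Ψ‖_{L²} ≤ δ` and `∫ |DΦ - G|² ≤ δ`
(Frobenius density). Proof: mollify (`φₙ ⋆ Ψ` is smooth, divergence free, `→ Ψ` in `L²` with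
`D(φₙ ⋆ Ψ) → G` in `L²`), then truncate with the Poincaré corrector
(`solenoidalTruncation`, `tendsto_lintegral_solenoidalTruncation_sub`). This is the whole-space
case of the density theorem `H¹_{0,σ} = closure of C_{c,σ}^∞` (Galdi 2011, Thm. III.4.3;
Sohr 2001, Lemma II.2.5.3), here with an elementary corrector instead of Bogovskiĭ's operator. [folklore] -/
theorem exists_isDivFree_test_approx (hE : finrank ℝ E = 3) {Ψ : E → E} {G : E → E →L[ℝ] E}
    (hΨ2 : MemLp Ψ 2 volume) (hdiv : IsWeaklyDivFree Ψ) (hG : HasWeakGradient Ψ G)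
    (hG2 : ∫⁻ x, ENNReal.ofReal (frobeniusNormSq (G x)) < ⊤) {δ : ℝ≥0∞} (hδ : 0 < δ) :
    ∃ Φ : E → E, FunctionSpaces.IsTestFunctionOn (⊤ : Opens E) Φ ∧ VectorCalculus.IsDivFree Φ ∧
      eLpNorm (Φ - Ψ) 2 volume ≤ δ ∧
      ∫⁻ x, ENNReal.ofReal (frobeniusNormSq (fderiv ℝ Φ x - G x)) ≤ δ := by
  obtain ⟨φ, hφ, -⟩ := FunctionSpaces.exists_contDiffBump_seq (E := E)
  set Vn : ℕ → E → E := fun n => (φ n).normed volume ⋆[lsmul ℝ ℝ, volume] Ψ with hVn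
  have hK : ∀ n, FunctionSpaces.IsTestFunctionOn (⊤ : Opens E) ((φ n).normed volume) := fun n =>
    FunctionSpaces.isTestFunctionOn_normed (φ n)
  have hVs : ∀ n, ContDiff ℝ ∞ (Vn n) := fun n => hG.contDiff_convolution (hK n)
  have hV1 : ∀ n, ContDiff ℝ 1 (Vn n) := fun n => hG.contDiff_convolution (hK n)
  have hVdiv : ∀ n, VectorCalculus.IsDivFree (Vn n) := fun n => isDivFree_normed_convolution hG hdiv (φ n)
  have hV2 : ∀ n, MemLp (Vn n) 2 volume := fun n => FunctionSpaces.memLp_normed_convolution (φ n) hΨ2 one_le_two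
  have hVL2 : ∀ n, ∫⁻ x, ‖Vn n x‖ₑ ^ 2 < ⊤ := fun n => by
    have h := lintegral_rpow_enorm_lt_top_of_eLpNorm_lt_top (by norm_num) (by norm_num)
      (hV2 n).eLpNorm_lt_top
    simpa only [ENNReal.toReal_ofNat, ENNReal.rpow_ofNat] using h
  have hDVL2 : ∀ n, ∫⁻ x, ‖fderiv ℝ (Vn n) x‖ₑ ^ 2 < ⊤ := fun n =>
    lt_of_le_of_lt (lintegral_mono fun x => by
        rw [← ENNReal.rpow_two]; exact enorm_sq_le_ofReal_frobeniusNormSq _)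
      ((lintegral_frobenius_fderiv_normed_convolution_le hG (φ n)).trans_lt hG2)
  -- convergence of the mollifications
  have hlimV : Tendsto (fun n => eLpNorm (Vn n - Ψ) 2 volume) atTop (𝓝 0) :=
    FunctionSpaces.tendsto_eLpNorm_normed_convolution_sub_self hφ one_le_two (by norm_num) hΨ2
  have hlimDV : Tendsto (fun n => ∫⁻ x, ENNReal.ofReal
      (frobeniusNormSq (fderiv ℝ (Vn n) x - G x))) atTop (𝓝 0) :=
    hG.tendsto_lintegral_frobenius_fderiv_convolution_sub hG2 hφ
  -- thresholds
  set ε : ℝ≥0∞ := δ / 12 with hε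
  have hεpos : 0 < ε := ENNReal.div_pos hδ.ne' (by norm_num)
  have h12ε : 12 * ε = δ := ENNReal.mul_div_cancel' (by norm_num) (by norm_num)
  have hδ2 : 0 < δ / 2 := ENNReal.half_pos hδ.ne'
  have hsq : 0 < (δ / 2) ^ 2 := ENNReal.pow_pos hδ2 2
  -- choose `n`
  obtain ⟨n, hn1, hn2⟩ := ((hlimV.eventually_lt_const hδ2).and (hlimDV.eventually_lt_const hεpos)).exists
  -- choose `R`
  obtain ⟨hR1, hR2⟩ := tendsto_lintegral_solenoidalTruncation_sub hE (hV1 n) (hVL2 n) (hDVL2 n)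
  obtain ⟨R, hRpos, hRa, hRb⟩ := ((eventually_gt_atTop (0 : ℝ)).and
    ((hR1.eventually_lt_const hsq).and (hR2.eventually_lt_const hεpos))).exists
  set Φ := solenoidalTruncation (Vn n) R with hΦ
  have hΦtest : FunctionSpaces.IsTestFunctionOn (⊤ : Opens E) Φ := isTestFunctionOn_solenoidalTruncation (hVs n) hRpos
  have hΦm : AEStronglyMeasurable Φ volume := hΦtest.contDiff.continuous.aestronglyMeasurable
  have hVm : AEStronglyMeasurable (Vn n) volume := (hV1 n).continuous.aestronglyMeasurable
  refine ⟨Φ, hΦtest, isDivFree_solenoidalTruncation hE (hV1 n) (hVdiv n) R, ?_, ?_⟩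
  · -- `L²` estimate
    have h1 : eLpNorm (Φ - Vn n) 2 volume ≤ δ / 2 := by
      rw [eLpNorm_eq_lintegral_rpow_enorm_toReal (by norm_num) (by norm_num)]
      simp only [ENNReal.toReal_ofNat, ENNReal.rpow_ofNat, one_div, Pi.sub_apply]
      have h2 := ENNReal.pow_rpow_inv_natCast (n := 2) two_ne_zero (δ / 2)
      rw [Nat.cast_ofNat] at h2
      rw [← h2]
      exact ENNReal.rpow_le_rpow hRa.le (by positivity)
    calc eLpNorm (Φ - Ψ) 2 volume = eLpNorm ((Φ - Vn n) + (Vn n - Ψ)) 2 volume := by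
          congr 1; abel
      _ ≤ eLpNorm (Φ - Vn n) 2 volume + eLpNorm (Vn n - Ψ) 2 volume :=
          eLpNorm_add_le (hΦm.sub hVm) (hVm.sub hΨ2.1) one_le_two
      _ ≤ δ / 2 + δ / 2 := add_le_add h1 hn1.le
      _ = δ := ENNReal.add_halves δ
  · -- gradient estimate
    have hcont : Continuous fun x => fderiv ℝ Φ x - fderiv ℝ (Vn n) x :=
      (hΦtest.contDiff.continuous_fderiv (by simp)).sub ((hV1 n).continuous_fderiv one_ne_zero)
    have hmeas : Measurable fun x => (2 : ℝ≥0∞) * ENNReal.ofReal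
        (frobeniusNormSq (fderiv ℝ Φ x - fderiv ℝ (Vn n) x)) :=
      (ENNReal.measurable_ofReal.comp (NSWeakStrongUniqueness.continuous_frobeniusNormSq.comp hcont).measurable).const_mul _
    calc ∫⁻ x, ENNReal.ofReal (frobeniusNormSq (fderiv ℝ Φ x - G x))
        ≤ ∫⁻ x, (2 * ENNReal.ofReal (frobeniusNormSq (fderiv ℝ Φ x - fderiv ℝ (Vn n) x)) +
            2 * ENNReal.ofReal (frobeniusNormSq (fderiv ℝ (Vn n) x - G x))) := by
          refine lintegral_mono fun x => ?_
          have h := FluidPDE.frobeniusNormSq_sub_le (fderiv ℝ Φ x - fderiv ℝ (Vn n) x)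
            (G x - fderiv ℝ (Vn n) x)
          have hsub : fderiv ℝ Φ x - fderiv ℝ (Vn n) x - (G x - fderiv ℝ (Vn n) x) =
              fderiv ℝ Φ x - G x := by abel
          rw [hsub, ← neg_sub (fderiv ℝ (Vn n) x) (G x), frobeniusNormSq_neg] at h
          calc ENNReal.ofReal (frobeniusNormSq (fderiv ℝ Φ x - G x))
              ≤ ENNReal.ofReal (2 * frobeniusNormSq (fderiv ℝ Φ x - fderiv ℝ (Vn n) x) +
                  2 * frobeniusNormSq (fderiv ℝ (Vn n) x - G x)) := ENNReal.ofReal_le_ofReal h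
            _ = _ := by
                rw [ENNReal.ofReal_add (mul_nonneg zero_le_two (frobeniusNormSq_nonneg _))
                  (mul_nonneg zero_le_two (frobeniusNormSq_nonneg _)),
                  ENNReal.ofReal_mul zero_le_two, ENNReal.ofReal_mul zero_le_two, ENNReal.ofReal_ofNat]
      _ = 2 * (∫⁻ x, ENNReal.ofReal (frobeniusNormSq (fderiv ℝ Φ x - fderiv ℝ (Vn n) x))) +
            2 * (∫⁻ x, ENNReal.ofReal (frobeniusNormSq (fderiv ℝ (Vn n) x - G x))) := by
          rw [lintegral_add_left hmeas, lintegral_const_mul' _ _ (by norm_num),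
            lintegral_const_mul' _ _ (by norm_num)]
      _ ≤ 2 * ((finrank ℝ E : ℝ≥0∞) * ∫⁻ x, ‖fderiv ℝ Φ x - fderiv ℝ (Vn n) x‖ₑ ^ 2) +
            2 * ε := by
          gcongr
          · calc ∫⁻ x, ENNReal.ofReal (frobeniusNormSq (fderiv ℝ Φ x - fderiv ℝ (Vn n) x))
                ≤ ∫⁻ x, (finrank ℝ E : ℝ≥0∞) * ‖fderiv ℝ Φ x - fderiv ℝ (Vn n) x‖ₑ ^ 2 :=
                  lintegral_mono fun x => ofReal_frobeniusNormSq_le_finrank_mul _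
              _ = _ := lintegral_const_mul' _ _ (by simp)
      _ ≤ 2 * ((3 : ℝ≥0∞) * ε) + 2 * ε := by
          rw [hE]
          push_cast
          gcongr
      _ = 8 * ε := by ring
      _ ≤ 12 * ε := by gcongr; norm_num
      _ = δ := h12ε

end Density

end Literature.Analysis.FluidPDE
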